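import Literature.MathematicalPhysics.QuantumFieldTheory.Balaban1983to89.FlowStep
import Literature.MathematicalPhysics.QuantumFieldTheory.Balaban1983to89.DagBinding
import Literature.MathematicalPhysics.QuantumFieldTheory.Balaban1983to89.B12Sec2to5
import Literature.MathematicalPhysics.QuantumFieldTheory.Balaban1983to89.B14FlowStep

/-!
# `Balaban1983to89.FlowStepRuns` — Theorem 2's regime for constructions generated by (0.20): (0.20) DERIVED along
in-interval runs, `B12.Thm2Printed` direct, the printed β-bound from (5.10) in the history typing, and non-vacuity of
the modelling clauses (kernel bookkeeping; located step T09.F)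

CITATION HEADER (lean-in-tree rule 2026-08-18).  This module belongs to the TYPED SKELETON of the published series
T. Bałaban, *Renormalization group approach to lattice gauge field theories. I. Generation of effective actions in a
small field approximation and a coupling constant renormalization in four dimensions*, Commun. Math. Phys. **109**,
249–301 (1987), doi:10.1007/bf01215223 [Balaban1987RG1] (cell paper B12; journal page = PDF page + 248), read together
with *Large field renormalization. II*, Commun. Math. Phys. **122**, 355–392 (1989) [Balaban1989LargeFieldII] (B16).
WHAT IS REPRODUCED: the definition of the effective couplings by the recursion (0.18)/(0.20) p. 255–256 (p. 255:
"Now we assume the existence of the first function, and we define the new coupling constant g_1 [by (0.18)]"; p. 256: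
"the coupling constant g_{k+1} is determined from the equation (0.20) … the sequence of actions and coupling constants
is defined for k = 0, 1, …, K"), the β-functions history-dependent as printed on p. 298, Theorem 2 p. 259 ((0.31)) as TARGET SHAPE (`B12.Thm2Printed`), and the bound
that §5 ((5.10) p. 293, (5.42) p. 297) yields for them; kernel-checked is only the BOOKKEEPING between these.  NOTHING
of the series is asserted: Theorem 2 is STATED WITHOUT PROOF in print (p. 259; [Balaban1989LargeFieldII] p. 355 "has
not been published yet") and is under adjudication by the audit cell `pub-balaban` (unit `b2b-balaban-strat-b12`,
located step T09.F).  Every `β ≥ b`-type hypothesis below (b = 0: the SIGN; b > 0: asymptotic freedom) and the joint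
continuity of the β-functions are LOCATED UNPRINTED INPUTS (cell MISSING-B12.md (M1)+(M2)), never facts.

WHY THIS MODULE (what it adds to `DagBinding` v3, carver p176840, and `FlowStep`, this unit p176429/p176508).
`DagBinding` v3 types how a construction `C : B12.Construction` uses ONE history-dependent family `β : FlowStep.HBeta`
(`DagBinding.ForwardGenerated`, `DagBinding.CurriesHBeta`) and proves `EndpointExistence` / `BetaBoundsInInterval` /
the headline `sect2Unconditional_of_flowStep` from box properties of `β` — but still ASSUMES the run-wise leaf
`rgFlow` ((0.20) for EVERY run, `hrg`).  Here: §1 adds the normalisation clause `HaltsOutside` (no coupling is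
produced where (0.20) has no positive solution — a TYPING CHOICE for the total Lean carrier; print determines g_{k+1}
"from the equation (0.20)" (p. 256) and does not discuss the no-solution case, the series being run only under the
standing hypothesis "0 < g_k ≤ γ for k = 0, 1, …, K" of Thms 1/3, pp. 259/264) and §2 DERIVES (0.20)
(`Flow.SatisfiesRG`) along every run that stays in the interval (`satisfiesRG_of_inInterval`), after a standalone
forward-uniqueness lemma; §3 proves that runs in Theorem 2's regime exist WITH (0.20), the discrete (0.31) and
monotonicity along the construction's own run (`regimeRun_exists`), whence `B12.Thm2Printed C L` DIRECTLY from box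
bounds with `b > 0` (no `rgFlow` hypothesis); §4 re-derives the carver's headline with `hrg` REMOVED
(`sect2Unconditional_of_nodes_hist`: the flow side then rests on the box properties of `β` alone); §5 discharges the
printed UPPER bound in the history typing from the (5.10)-decay of the vacuum-polarization kernels (sub-cell B12's
`B12Sec2to5.secondMoment_abs_le_of_decay510`; the history-typed version was that sub-cell's open follow-up D-b03.3) and
records the perturbative / one-loop-split routes to `B12.Thm2Printed`; §6 proves NON-VACUITY: for every family `β`
the canonical forward recursion is a construction satisfying `ForwardGenerated ∧ CurriesHBeta ∧ HaltsOutside`, so the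
modelling clauses add no hidden constraint; §7 (v1.2) determines what the endpoint-existence half needs EXACTLY —
partial sums of the β's bounded below along box histories (`BetaPartialSumsLowerH`; sufficient by shooting,
necessary along realised runs by telescoping), strictly weaker than the sign (kernel witness `sign_not_necessary`).
After this module the flow-side inputs of the cell's DAG headline are exactly `FlowStep.BetaLowerH b γ₀ β` (b > 0,
for (0.31)) — resp. `BetaPartialSumsLowerH M γ₀ β` for the regime hypothesis alone — and `FlowStep.BetaContH γ₀ β`
(T09.F), plus the three modelling clauses.

§9 (v1.4): what the PRINTED two-sided bound |β| ≤ β′ alone gives — bare couplings for each FIXED K with an ε-DEPENDENT smallness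
`g ≤ (1/γ² + β′K)^{−1/2}` (`endpoint_fixedK_of_absBound`, `endpointK_of_decay510`); Theorem 2 = the same with g⋆ uniform in K:
the gap is exactly the quantifier swap, i.e. the K-uniformity in (A-ps).
§8 (v1.3): the p. 355 unconditional reading (`B16.Sect2Unconditional` ∧ (0.1) unconditional) consumes only the
endpoint-existence half, and (2.6) along runs only a partial-sum bound (strat-b14's `B14FlowStep.flow26d_of_partialSum_ge`):
`p355Unconditional_of_partialSums` derives it from (A-ps) with neither the sign nor `b > 0` nor (0.31).
§10 (v1.5): the one-loop LIMIT form.  The one-loop coefficients β⁰_{k+1} of the printed split depend on k (through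
η = L^{−k}; cell HOME/BETA/OBJECTS.md §4); the analysis can at best deliver β⁰_{k+1} → β⁰_∞ at a geometric rate plus the
remainder bound (AF-1).  These already give (A-ps) with the explicit constant c₀/(1−θ) and NO information on the signs of
the finitely many small-k coefficients (`betaPartialSumsLowerH_of_limitSplit`, `endpointExistence_of_limitSplit`,
`p355Unconditional_of_limitSplit`); positivity from an explicit k₀ on (`betaLower_tail_of_limitSplit`); the two-sided
(0.31) for ALL k needs in addition exactly the finite list of small-k signs (`thm2Printed_of_limitSplit`).
§11 (v1.7, appended by the [III]-side co-lead strat-b14): the limit form also gives, along every in-interval run, ALL of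
(2.6)–(2.9) AND the coupling-sum step (2.46) of [Balaban1988Convergent] p. 263 (`flowControl_along_of_limitSplit`,
`p355Unconditional_and_sum246_of_limitSplit`) via strat-b14's `B14FlowStep` §J (averaged asymptotic freedom with a
defect = (0.31)-lower up to an additive constant) — so the finite list of small-k signs is consumed by the literal (0.31)
and by no other located consumer of the flow.  MINIMAL FORM, both sides (`betaPartialSumsLowerH_of_eventualLower`,
`endpointExistence_of_eventualLower`, `p355Unconditional_and_sum246_of_eventualLower`): an EVENTUAL positive lower bound
`β_{k+1} ≥ b > 0` on the boxes for `k ≥ k₀` + the printed two-sided bound + continuity already give the endpoint half, the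
p. 355 reading and (2.46) along runs — no split, no rate; the limit form is one route to that eventual bound.  And
even the LITERAL lower half of (0.31) follows from the eventual bound, with `b/2` in place of `b`, on every run with
`K ≥ k₀(3 + 2β′/b)` steps (`discrete031_lower_of_eventualLower_largeK`): the small-k signs bear on (0.31) only for
finitely many lattice spacings `ε = L^{−K}`.  (v1.8, co-lead) `flowControl_along_of_eventualLower` / `…'`: the
history-typed [III]-side bridge for the minimal form — (EV-AF) + the printed two-sided bound + `SmallnessFor` +
γ-smallness of the defect `(b+β′)k₀` ⇒ ALL of (2.6)–(2.9) AND (2.46) along every in-interval run (via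
`B14FlowStep.flowControl_of_eventualLower`), so the eventual form carries the same [III]-side consumer list as the limit
form.

Imports `FlowStep`, `DagBinding` (→ `Dag`, `Step`, `B4`–`B16` bundles), `B12Sec2to5`, `B14FlowStep` (v1.6 for §11); restates nothing of them.
Mathlib only otherwise; no `sorry`/`axiom`.  Cell prose: HOME/b2b-balaban-strat-b12/MISSING-B12.md (v2).
-/

namespace Literature.MathematicalPhysics.QuantumFieldTheory.Balaban1983to89.FlowStepRuns

open Literature.MathematicalPhysics.QuantumFieldTheory.Balaban1983to89
open FlowStep DagBinding

noncomputable section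

/-! ## 1. The halting clause (normalisation of the carrier where (0.20) has no positive solution) -/

/-- NORMALISATION OF JUNK VALUES: where (0.20) has no positive solution (`1/g_k² − β_{k+1}(g_0,…,g_k) ≤ 0` after a
positive history) the construction produces no coupling — in the total Lean carrier, a NON-POSITIVE value.  Print:
p. 255 "we define the new coupling constant g_1 [by (0.18)]", p. 256 "the coupling constant g_{k+1} is determined from
the equation (0.20)"; the case in which (0.20) has no solution is NOT discussed in print (the series is run only under
the standing hypothesis "0 < g_k ≤ γ for k = 0, 1, …, K" of Thms 1/3, pp. 259/264), so this clause is a TYPING CHOICE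
for the totalised carrier (cell DIVERGENCE D-sb12-2), shown to cost nothing by `modelOf` (§6).  Complements
`DagBinding.ForwardGenerated` (which speaks only where the right side is positive); used to derive (0.20) along runs
that DO stay in the interval (§2).  A modelling clause about the cell's carriers, not a statement of the series. [cite: Balaban1987RG1, (0.18)–(0.20) pp.255–256] -/
def HaltsOutside (C : B12.Construction) (β : HBeta) : Prop :=
  ∀ (P : B12.RunParams) (k : ℕ), k < P.K → (∀ i, i ≤ k → 0 < (C P).flow.g i) →
    1 / ((C P).flow.g k) ^ 2 - β k (prefixOf (C P).flow.g k) ≤ 0 → (C P).flow.g (k + 1) ≤ 0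

/-! ## 2. Forward uniqueness; (0.20) DERIVED along in-interval runs -/

/-- FORWARD UNIQUENESS (standalone form of the induction inside `DagBinding.endpointExistence_of_forwardGenerated` /
`FlowStep.B12Thm2Shape_of_betaBoundsH`).  A coupling sequence `F.g` generated forward by (0.20) (clause `hstep`) from
`F.g 0 = gs 0` agrees up to `K` with any POSITIVE solution `gs` of the history recursion `RGEqH K β`.  The history
dependence is why agreement of the whole prefix is carried through the induction. [folklore] -/
theorem flow_eq_of_rgEqH (F : Flow) (β : HBeta) (K : ℕ)
    (hstep : ∀ k, k < K → (∀ i, i ≤ k → 0 < F.g i) → 0 < 1 / (F.g k) ^ 2 - β k (prefixOf F.g k) →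
      0 < F.g (k + 1) ∧ 1 / (F.g (k + 1)) ^ 2 = 1 / (F.g k) ^ 2 - β k (prefixOf F.g k))
    {gs : ℕ → ℝ} (h0 : F.g 0 = gs 0) (hrg : RGEqH K β gs) (hpos : ∀ k, k ≤ K → 0 < gs k) :
    ∀ k, k ≤ K → F.g k = gs k := by
  have agree : ∀ k, k ≤ K → ∀ i, i ≤ k → F.g i = gs i := by
    intro k
    induction k with
    | zero => intro _ i hi; obtain rfl := Nat.le_zero.mp hi; exact h0
    | succ k ih =>
      intro hk i hi
      have hkK : k < K := Nat.lt_of_succ_le hk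
      rcases Nat.lt_or_eq_of_le hi with hlt | rfl
      · exact ih hkK.le i (Nat.lt_succ_iff.mp hlt)
      · have hprev : ∀ i, i ≤ k → F.g i = gs i := ih hkK.le
        have hpre : prefixOf F.g k = prefixOf gs k := by
          funext j; simp [prefixOf, hprev j (Nat.lt_succ_iff.mp j.isLt)]
        have hgk : F.g k = gs k := hprev k le_rfl
        have hpos_k1 : 0 < gs (k + 1) := hpos (k + 1) hk
        have hrgk : 1 / (gs k) ^ 2 = 1 / (gs (k + 1)) ^ 2 + β k (prefixOf gs k) := hrg k hkK
        have hrhs : 0 < 1 / (gs k) ^ 2 - β k (prefixOf gs k) := by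
          rw [hrgk, add_sub_cancel_right]; positivity
        have hposAll : ∀ i, i ≤ k → 0 < F.g i :=
          fun i hi => by rw [hprev i hi]; exact hpos i (hi.trans hkK.le)
        obtain ⟨hpos', heq'⟩ := hstep k hkK hposAll (by rw [hgk, hpre]; exact hrhs)
        rw [hgk, hpre, hrgk, add_sub_cancel_right] at heq'
        have hsq : (F.g (k + 1)) ^ 2 = (gs (k + 1)) ^ 2 := by
          have h1 : ((F.g (k + 1)) ^ 2)⁻¹ = ((gs (k + 1)) ^ 2)⁻¹ := by simpa only [one_div] using heq'
          exact inv_inj.mp h1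
        exact (pow_left_inj₀ hpos'.le hpos_k1.le (by norm_num)).mp hsq
  exact fun k hk => agree K le_rfl k hk

/-- **(0.20) DERIVED, not assumed.**  Along a run that stays in some `]0,γ]` up to `K`, a forward-generated
construction (`DagBinding.ForwardGenerated`) that halts outside and whose run-wise β-functions curry `β`
(`DagBinding.CurriesHBeta`) SATISFIES (0.20) in the cell's `Setup.Flow.SatisfiesRG` form — the carver's leaf
`rgFlow`: at each step the right side of (0.20) must be positive (else the next coupling would be non-positive), so
the generation clause applies, and the dictionary identifies `β_{k+1}(g_k)` with `β k (g_0,…,g_k)`. [cite: Balaban1987RG1, (0.20) p.256] -/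
theorem satisfiesRG_of_inInterval {C : B12.Construction} {β : HBeta} (hgen : ForwardGenerated C β)
    (hhalt : HaltsOutside C β) (hcur : CurriesHBeta C β) (P : B12.RunParams) {γ : ℝ}
    (hI : (C P).flow.InInterval γ P.K) : (C P).flow.SatisfiesRG P.K := by
  intro k hk
  have hposAll : ∀ i, i ≤ k → 0 < (C P).flow.g i := fun i hi => (hI i (hi.trans hk.le)).1
  have hcurk : (C P).flow.β (k + 1) ((C P).flow.g k) = β k (prefixOf (C P).flow.g k) := by
    rw [hcur P k _ hk, update_prefixOf_last]
  by_cases hrhs : 0 < 1 / ((C P).flow.g k) ^ 2 - β k (prefixOf (C P).flow.g k)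
  · obtain ⟨-, heq⟩ := hgen.2 P k hk hposAll hrhs
    rw [hcurk, heq]; ring
  · exfalso
    have h1 : (C P).flow.g (k + 1) ≤ 0 := hhalt P k hk hposAll (not_lt.mp hrhs)
    exact absurd (hI (k + 1) (Nat.succ_le_of_lt hk)).1 (not_lt.mpr h1)

/-- Hence, under the dictionary, an in-interval run also solves the HISTORY recursion `FlowStep.RGEqH`
(`DagBinding.rgEqH_of_curries` applied to the derived (0.20)). [cite: Balaban1987RG1, (0.20) p.256] -/
theorem rgEqH_of_inInterval {C : B12.Construction} {β : HBeta} (hgen : ForwardGenerated C β)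
    (hhalt : HaltsOutside C β) (hcur : CurriesHBeta C β) (P : B12.RunParams) {γ : ℝ}
    (hI : (C P).flow.InInterval γ P.K) : RGEqH P.K β (C P).flow.g :=
  rgEqH_of_curries C β hcur P (satisfiesRG_of_inInterval hgen hhalt hcur P hI)

/-! ## 3. Runs in Theorem 2's regime WITH (0.20), (0.31) and monotonicity; `B12.Thm2Printed` direct -/

/-- **Runs in Theorem 2's regime exist, with their structure**, for a forward-generated construction whose β-family is
continuous with `0 ≤ b ≤ β_{k+1} ≤ β'` on the boxes `]0,γ₀]^{k+1}`: for every torus exponent `m`, `γ ∈ ]0,γ₀]`,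
renormalised `g ∈ ]0,γ]` and every `K` there is a bare coupling `g₀` whose run stays in `]0,γ]`, ends at `g_K = g`,
solves the history recursion (0.20), obeys the discrete (0.31) with `b, β'` and is non-decreasing in `k`.
= `FlowStep.couplingTrajectory_exists_hist` + forward uniqueness.  (`DagBinding.endpointExistence_of_forwardGenerated`
is the first two conjuncts with `b = 0`.)  A REDUCTION: `hlo` (any `b ≥ 0`) and `hcont` are supplied by no printed
source; `hup` is printed (p. 264; §5). [cite: Balaban1987RG1, Thm 2 (0.31) p.259 and (0.18)–(0.20) pp.255–256] -/
theorem regimeRun_exists {C : B12.Construction} {β : HBeta} (hgen : ForwardGenerated C β) {γ₀ b β' : ℝ}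
    (hb : 0 ≤ b) (hbβ' : b ≤ β') (hcont : BetaContH γ₀ β) (hlo : BetaLowerH b γ₀ β) (hup : BetaUpperH β' γ₀ β)
    (m : ℕ) {γ : ℝ} (hγ : 0 < γ) (hγle : γ ≤ γ₀) {g : ℝ} (hg : 0 < g) (hgγ : g ≤ γ) (K : ℕ) :
    ∃ g0 : ℝ, (C ⟨K, m, g0⟩).flow.InInterval γ K ∧ (C ⟨K, m, g0⟩).flow.g K = g ∧
      RGEqH K β (C ⟨K, m, g0⟩).flow.g ∧ Step.Discrete031 b β' K g (C ⟨K, m, g0⟩).flow.g ∧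
        ∀ k, k < K → (C ⟨K, m, g0⟩).flow.g k ≤ (C ⟨K, m, g0⟩).flow.g (k + 1) := by
  have hcont' : BetaContH γ β := fun k => (hcont k).mono (box_mono hγle k)
  have hlo' : BetaLowerH b γ β := fun k v hv => hlo k v (box_mono hγle k hv)
  have hup' : BetaUpperH β' γ β := fun k v hv => hup k v (box_mono hγle k hv)
  obtain ⟨gs, hgsK, hrg, hI, hD, hmono⟩ :=
    couplingTrajectory_exists_hist β hγ hb hbβ' hcont' hlo' hup' K g hg hgγ
  have heq : ∀ k, k ≤ K → (C ⟨K, m, gs 0⟩).flow.g k = gs k :=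
    flow_eq_of_rgEqH (C ⟨K, m, gs 0⟩).flow β K (fun k hk => hgen.2 ⟨K, m, gs 0⟩ k hk)
      (hgen.1 ⟨K, m, gs 0⟩) hrg (fun k hk => (hI k hk).1)
  have hpre : ∀ k, k ≤ K → prefixOf (C ⟨K, m, gs 0⟩).flow.g k = prefixOf gs k := by
    intro k hk
    funext j
    simp [prefixOf, heq j ((Nat.lt_succ_iff.mp j.isLt).trans hk)]
  refine ⟨gs 0, fun k hk => ?_, ?_, fun k hk => ?_, fun k hk => ?_, fun k hk => ?_⟩
  · rw [heq k hk]; exact hI k hk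
  · rw [heq K le_rfl]; exact hgsK
  · rw [heq k hk.le, heq (k + 1) hk, hpre k hk.le]; exact hrg k hk
  · rw [heq k hk]; exact hD k hk
  · rw [heq k hk.le, heq (k + 1) hk]; exact hmono k hk

/-- The (0.31) coefficient algebra: `(c / log L) · (x log L) = c x` for `L > 1`. [folklore] -/
theorem coeff_logL (c L x : ℝ) (hL : 1 < L) : c / Real.log L * (x * Real.log L) = c * x := by
  have hlog : Real.log L ≠ 0 := (Real.log_pos hL).ne'
  field_simp

/-- **`B12.Thm2Printed C L` (Theorem 2 AS PRINTED, incl. (0.31)) DIRECTLY from box bounds with `b > 0`** — joint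
continuity and `0 < b ≤ β_{k+1} ≤ β'` on `]0,γ₀]^{k+1}`, for a construction generated forward by (0.20) with `β`;
(0.31) constants `β = b / log L`, `β' / log L` (`L > 1` the block size as a real, `log(L^kε)⁻¹ = (K − k) log L`).
Unlike `DagBinding.thm2Printed_of_endpointExistence`, no run-wise (0.20) leaf is assumed: (0.20) holds along the
constructed run by `regimeRun_exists`.  A REDUCTION to the located unprinted input `hlo` (b > 0) + `hcont`. [cite: Balaban1987RG1, Thm 2 (0.31) p.259] -/
theorem thm2Printed_of_boxBoundsH {C : B12.Construction} {β : HBeta} (hgen : ForwardGenerated C β)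
    {L γ₀ b β' : ℝ} (hL : 1 < L) (hγ₀ : 0 < γ₀) (hb : 0 < b) (hbβ' : b ≤ β') (hcont : BetaContH γ₀ β)
    (hlo : BetaLowerH b γ₀ β) (hup : BetaUpperH β' γ₀ β) : B12.Thm2Printed C L := by
  intro m
  refine ⟨γ₀, hγ₀, fun γ hγ hγle => ⟨γ, hγ, fun g hg hgγ => ?_⟩⟩
  have hlog : 0 < Real.log L := Real.log_pos hL
  refine ⟨b / Real.log L, β' / Real.log L, div_pos hb hlog, div_le_div_of_nonneg_right hbβ' hlog.le,
    fun K => ?_⟩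
  obtain ⟨g0, hI, hK, -, hD, -⟩ := regimeRun_exists hgen hb.le hbβ' hcont hlo hup m hγ hγle hg hgγ K
  refine ⟨g0, hI, hK, fun k hk => ?_⟩
  rw [coeff_logL b L _ hL, coeff_logL β' L _ hL]
  exact hD k hk

/-- The same in the readers' B16 vocabulary: `B16.Thm2Shape C L` (= `B12.Thm2Printed C.toB12 L`). [cite: Balaban1987RG1, Thm 2 (0.31) p.259] -/
theorem thm2Shape_of_boxBoundsH {C : B16.Construction} {β : HBeta} (hgen : ForwardGenerated C.toB12 β)
    {L γ₀ b β' : ℝ} (hL : 1 < L) (hγ₀ : 0 < γ₀) (hb : 0 < b) (hbβ' : b ≤ β') (hcont : BetaContH γ₀ β)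
    (hlo : BetaLowerH b γ₀ β) (hup : BetaUpperH β' γ₀ β) : B16.Thm2Shape C L :=
  thm2Printed_of_boxBoundsH hgen hL hγ₀ hb hbβ' hcont hlo hup

/-! ## 4. The carver's headline with the run-wise (0.20) leaf REMOVED -/

/-- The pinned end statement (B) (`B16.EndStatementB`, conditional form) from the thirteen paper nodes at the bound
leaves, for a world whose construction is forward-generated by (0.20) with a curried family `β` and halts outside,
with `b ≤ β ≤ β⁺` on the boxes `]0,γ₀]^{k+1}`, `γ ≤ γ₀`: (0.20) holds along every in-interval run
(`satisfiesRG_of_inInterval`), the bounds hold at the points `g_j` (`DagBinding.alongRun_of_inInterval`), and (2.6)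
follows (`DagBinding.flowIneq26_of_alongRun`).  No `rgFlow`/`betaPositive` leaf is assumed run-wise. [cite: Balaban1989LargeFieldII, Thm 1 + (0.1) pp.355–356] -/
theorem endStatementB_of_nodes_hist (w : World) (hγ : 0 < w.γ) {γ₀ : ℝ} (hγ₀ : w.γ ≤ γ₀)
    (hnodes : ∀ P, Nodes (leaves w P)) {β : HBeta} (hgen : ForwardGenerated w.C.toB12 β)
    (hhalt : HaltsOutside w.C.toB12 β) (hcur : CurriesHBeta w.C.toB12 β)
    (hlo : BetaLowerH w.b γ₀ β) (hup : BetaUpperH w.βup γ₀ β) : B16.EndStatementB w.C := by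
  refine endStatementB_of_worlds w hγ fun P => uvStability_of_nodes _ (hnodes P) ?_
  intro hsc
  have hrg : (w.C P).flow.SatisfiesRG P.K := satisfiesRG_of_inInterval hgen hhalt hcur P hsc
  obtain ⟨hlo', hhi'⟩ :=
    alongRun_of_inInterval w.C.toB12 (betaBoundsInInterval_of_boxBounds w.C.toB12 β hcur hlo hup) hγ₀ P hsc
  exact flowIneq26_of_alongRun w P hrg hhi' hlo' fun k hk => (hsc k hk).1

/-- **HEADLINE (history form, no run-wise flow leaf).**  For a world `w` (`0 < γ ≤ γ₀`, `b ≤ β⁺`; `b > 0`, `L > 1`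
are world data): if for every run the thirteen paper nodes of the DAG hold at the bound leaves, if the construction
is generated forward by (0.20) from the bare coupling with ONE history-dependent β-family `β` which its run-wise
β-functions curry and outside whose domain it halts, and if `β` is jointly continuous with `b ≤ β ≤ β⁺` on the boxes
`]0,γ₀]^{k+1}` — upper bound printed ([Balaban1987RG1] p. 264, via (5.10): §5), lower bound and continuity UNPRINTED
(T09.F) — then the densities have the §2 form and the bound (0.1) holds WITHOUT the coupling hypothesis, in Theorem
2's regime (the unconditional reading claimed on p. 355 of [Balaban1989LargeFieldII]).  = `DagBinding.
sect2Unconditional_of_flowStep` with its hypothesis `hrg : ∀ P, rgFlow` DISCHARGED (traded for `HaltsOutside`, which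
§6 shows costs nothing).  Bookkeeping only; nothing of the series is asserted. [cite: Balaban1989LargeFieldII, p.355] -/
theorem sect2Unconditional_of_nodes_hist (w : World) (hγ : 0 < w.γ) {γ₀ : ℝ} (hγ₀ : w.γ ≤ γ₀)
    (hbup : w.b ≤ w.βup) (hnodes : ∀ P, Nodes (leaves w P)) {β : HBeta}
    (hgen : ForwardGenerated w.C.toB12 β) (hhalt : HaltsOutside w.C.toB12 β) (hcur : CurriesHBeta w.C.toB12 β)
    (hcont : BetaContH γ₀ β) (hlo : BetaLowerH w.b γ₀ β) (hup : BetaUpperH w.βup γ₀ β) :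
    B16.Sect2Unconditional w.C ∧
      ∃ Em Ep : ℝ, ∀ m : ℕ, ∃ gstar : ℝ, 0 < gstar ∧ ∀ g : ℝ, 0 < g → g ≤ gstar →
        ∀ K : ℕ, ∃ g0 : ℝ, (w.C ⟨K, m, g0⟩).flow.g K = g ∧
          ∀ k, k ≤ K → ∀ V : (w.C ⟨K, m, g0⟩).Cfg k, B16.UVIneq (w.C ⟨K, m, g0⟩) k V Em Ep := by
  have hB : B16.EndStatementB w.C := endStatementB_of_nodes_hist w hγ hγ₀ hnodes hgen hhalt hcur hlo hup
  have h2 : B16.Thm2Shape w.C w.L :=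
    thm2Shape_of_boxBoundsH hgen w.one_lt_L (lt_of_lt_of_le hγ hγ₀) w.b_pos hbup hcont hlo hup
  exact ⟨B16.sect2_unconditional_of_Thm2 w.C w.L hB.1 h2, B16.uv_unconditional_of_Thm2 w.C w.L hB.2 h2⟩

/-! ## 5. The printed upper bound discharged from (5.10) (history typing); perturbative and one-loop-split forms -/

/-- **Edge B12 §5 → box bounds, history typing.**  If `β k v` is the second moment (1.22)/(5.42) of a
vacuum-polarization component kernel `Π^{(k+1)}(v; ·)` (`B12Beta.secondMoment`, μ ≠ ν fixed) obeying the decay (5.10)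
with constants `Cst = O(1)E₀`, `δ₁ > 0` uniformly for histories `v ∈ ]0,γ]^{k+1}`, then `−β′ ≤ β ≤ β′` on the boxes
with `β′ = B12Sec2to5.betaPrime510 d Cst δ₁ = Cst · Σ_x |x|₁² e^{−δ₁|x|₁}` — the k-uniform ABSOLUTE bound that §5
actually yields (sub-cell B12's `secondMoment_abs_le_of_decay510`; Markov version `betaUpper_of_decay510`).  The
upper half is the printed p. 264 property; the lower half is NOT the positive lower bound Theorem 2 needs (cell GAPS
G-adv2-3). [cite: Balaban1987RG1, (5.10) p.293 and (5.42) p.297] -/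
theorem betaBoundsH_of_decay510 {d : ℕ} (μ ν : Fin d)
    (PfamH : (k : ℕ) → (Fin (k + 1) → ℝ) → B12Beta.Kernel d) (β : HBeta) {γ Cst δ₁ : ℝ} (hδ : 0 < δ₁)
    (hβ : ∀ k v, β k v = B12Beta.secondMoment (PfamH k v) μ ν)
    (hdec : ∀ k v, v ∈ Box γ k → B12Sec2to5.Decay510 (PfamH k v μ ν) Cst δ₁) :
    BetaUpperH (B12Sec2to5.betaPrime510 d Cst δ₁) γ β ∧
      BetaLowerH (-B12Sec2to5.betaPrime510 d Cst δ₁) γ β := by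
  refine ⟨fun k v hv => ?_, fun k v hv => ?_⟩
  · rw [hβ k v]
    exact le_trans (le_abs_self _) (B12Sec2to5.secondMoment_abs_le_of_decay510 hδ (hdec k v hv)).2
  · rw [hβ k v]
    exact neg_le_of_abs_le (B12Sec2to5.secondMoment_abs_le_of_decay510 hδ (hdec k v hv)).2

/-- **Endpoint existence with the printed half discharged.**  For a construction generated forward by (0.20) whose
β-family is (5.42) of kernels obeying (5.10) uniformly on the boxes `]0,γ₀]^{k+1}`: the SIGN `β ≥ 0` there and the
joint continuity ALONE yield `DagBinding.EndpointExistence C` (the upper bound comes from (5.10); composition with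
`DagBinding.endpointExistence_of_forwardGenerated`).  The residual hypotheses `hsign`, `hcont` (and (5.10) itself,
stated on p. 293 as what "the representation (4.37) yields", no derivation printed, cell GAPS G-B12s-15) are exactly the located inputs. [cite: Balaban1987RG1, Thm 2 p.259 and (5.10) p.293] -/
theorem endpointExistence_of_sign_decay510 {C : B12.Construction} {β : HBeta} (hgen : ForwardGenerated C β)
    {d : ℕ} (μ ν : Fin d) (PfamH : (k : ℕ) → (Fin (k + 1) → ℝ) → B12Beta.Kernel d) {γ₀ Cst δ₁ : ℝ}
    (hγ₀ : 0 < γ₀) (hδ : 0 < δ₁) (hβ : ∀ k v, β k v = B12Beta.secondMoment (PfamH k v) μ ν)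
    (hdec : ∀ k v, v ∈ Box γ₀ k → B12Sec2to5.Decay510 (PfamH k v μ ν) Cst δ₁)
    (hcont : BetaContH γ₀ β) (hsign : BetaLowerH 0 γ₀ β) : EndpointExistence C := by
  obtain ⟨hup, -⟩ := betaBoundsH_of_decay510 μ ν PfamH β hδ hβ hdec
  -- 0 ≤ β′: evaluate sign and upper bound at the constant history γ₀ of length 1
  have hmem : (fun _ : Fin (0 + 1) => γ₀) ∈ Box γ₀ 0 := mem_box.mpr fun _ => ⟨hγ₀, le_rfl⟩
  have hβ' : 0 ≤ B12Sec2to5.betaPrime510 d Cst δ₁ := (hsign 0 _ hmem).trans (hup 0 _ hmem)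
  exact endpointExistence_of_forwardGenerated C β hγ₀ hβ' hcont hsign hup hgen

/-- `B12.Thm2Printed` with the printed half discharged: forward generation + (5.42)/(5.10) on the boxes + continuity
+ a POSITIVE lower bound `b` (T09.F, strong form) ⇒ Theorem 2 as printed, with (0.31) constants `b / log L` and
`β′₅.₁₀ / log L`. [cite: Balaban1987RG1, Thm 2 (0.31) p.259 and (5.10) p.293] -/
theorem thm2Printed_of_lower_decay510 {C : B12.Construction} {β : HBeta} (hgen : ForwardGenerated C β)
    {d : ℕ} (μ ν : Fin d) (PfamH : (k : ℕ) → (Fin (k + 1) → ℝ) → B12Beta.Kernel d) {L γ₀ b Cst δ₁ : ℝ}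
    (hL : 1 < L) (hγ₀ : 0 < γ₀) (hb : 0 < b) (hδ : 0 < δ₁)
    (hβ : ∀ k v, β k v = B12Beta.secondMoment (PfamH k v) μ ν)
    (hdec : ∀ k v, v ∈ Box γ₀ k → B12Sec2to5.Decay510 (PfamH k v μ ν) Cst δ₁)
    (hcont : BetaContH γ₀ β) (hlo : BetaLowerH b γ₀ β) : B12.Thm2Printed C L := by
  obtain ⟨hup, -⟩ := betaBoundsH_of_decay510 μ ν PfamH β hδ hβ hdec
  have hmem : (fun _ : Fin (0 + 1) => γ₀) ∈ Box γ₀ 0 := mem_box.mpr fun _ => ⟨hγ₀, le_rfl⟩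
  have hbβ' : b ≤ B12Sec2to5.betaPrime510 d Cst δ₁ := (hlo 0 _ hmem).trans (hup 0 _ hmem)
  exact thm2Printed_of_boxBoundsH hgen hL hγ₀ hb hbβ' hcont hlo hup

/-- Theorem 2 as printed from the PERTURBATIVE form `FlowStep.BetaPertH β β̄` (`β̄ > 0`, k-uniform `O(γ²)` remainder —
the cell's typing of [Balaban1989LargeFieldII] p. 355 "second order perturbative calculations") + continuity, for
forward-generated constructions.  (Chains `betaAFH_of_pert`, `betaUpperH_of_pert`, `thm2Printed_of_boxBoundsH`.) [cite: Balaban1989LargeFieldII, p.355] -/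
theorem thm2Printed_of_pertH {C : B12.Construction} {β : HBeta} (hgen : ForwardGenerated C β) {L βbar γc : ℝ}
    (hL : 1 < L) (hbar : 0 < βbar) (hpert : BetaPertH β βbar) (hγc : 0 < γc) (hcont : BetaContH γc β) :
    B12.Thm2Printed C L := by
  obtain ⟨γ₁, hγ₁, b, hb, hlo⟩ := betaAFH_of_pert hbar hpert
  obtain ⟨γ₂, hγ₂, b'', hup⟩ := betaUpperH_of_pert hpert
  set γ₀ : ℝ := min γc (min γ₁ γ₂) with hγ₀def
  have hγ₀ : 0 < γ₀ := lt_min hγc (lt_min hγ₁ hγ₂)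
  have h0c : γ₀ ≤ γc := min_le_left _ _
  have h01 : γ₀ ≤ γ₁ := (min_le_right _ _).trans (min_le_left _ _)
  have h02 : γ₀ ≤ γ₂ := (min_le_right _ _).trans (min_le_right _ _)
  exact thm2Printed_of_boxBoundsH hgen hL hγ₀ hb (le_max_left b b'')
    (fun k => (hcont k).mono (box_mono h0c k))
    (fun k v hv => hlo k v (box_mono h01 k hv))
    (fun k v hv => (hup k v (box_mono h02 k hv)).trans (le_max_right _ _))

/-- Theorem 2 as printed from sub-cell B12's PRINTED ONE-LOOP SPLIT `B12Beta.OneLoopSplit β`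
(`β_{k+1} = β⁰_{k+1} + β¹_{k+1}(g_0,…,g_k)`, (2.12)–(2.14) p. 268) with (AF-0) `2b ≤ β⁰_{k+1}` (b > 0), (AF-1)
`|β¹_{k+1}| ≤ C g_k` on `]0,γ₀]^{k+1}`, `Cγ₀ ≤ b`, an upper bound and continuity — for forward-generated constructions.
(AF-0)/(AF-1) are the cell's (M2)/(M1): UNPRINTED. [cite: Balaban1987RG1, Thm 2 p.259 and (2.12)–(2.14) p.268] -/
theorem thm2Printed_of_splitH {C : B12.Construction} {β : HBeta} (hgen : ForwardGenerated C β)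
    (S : B12Beta.OneLoopSplit β) {L b Cr γ₀ β' : ℝ} (hL : 1 < L) (hγ₀ : 0 < γ₀) (hb : 0 < b)
    (hAF0 : ∀ k, 2 * b ≤ S.β0 k)
    (hAF1 : ∀ k (p : Fin (k + 1) → ℝ), p ∈ B12Beta.HistBox γ₀ k → |S.β1 k p| ≤ Cr * p (Fin.last k))
    (hCr : 0 ≤ Cr) (hγ : Cr * γ₀ ≤ b) (hup : BetaUpperH β' γ₀ β) (hcont : BetaContH γ₀ β) :
    B12.Thm2Printed C L := by
  have hlo : BetaLowerH b γ₀ β := betaLowerH_of_split S hAF0 hAF1 hCr hγ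
  have hmem : (fun _ : Fin (0 + 1) => γ₀) ∈ Box γ₀ 0 := mem_box.mpr fun _ => ⟨hγ₀, le_rfl⟩
  have hbβ : b ≤ β' := (hlo 0 _ hmem).trans (hup 0 _ hmem)
  exact thm2Printed_of_boxBoundsH hgen hL hγ₀ hb hbβ hcont hlo hup

/-! ## 6. Non-vacuity of the modelling clauses: the construction CANONICALLY generated by a β-family

For ANY family `β` there is a construction (trivial non-flow data) that is `ForwardGenerated`, `HaltsOutside` and
`CurriesHBeta` for `β`: run (0.20) forward from the bare coupling, producing the positive solution while the right
side is positive and `0` afterwards.  So the hypotheses of §§3–4 (and of `DagBinding.sect2Unconditional_of_flowStep`)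
are jointly satisfiable exactly when the box properties of `β` and the node leaves are — the three modelling clauses
add no hidden constraint (cf. the cell's vacuity audits, REFEREE.md). -/

/-- The positive solution `g = y^{-1/2}` of `1/g² = y` when `y > 0`; `0` ("no coupling") otherwise. [folklore] -/
def solveCoupling (y : ℝ) : ℝ := if 0 < y then 1 / Real.sqrt y else 0

/-- `y > 0 ⇒ solveCoupling y > 0`. [folklore] -/
theorem solveCoupling_pos {y : ℝ} (hy : 0 < y) : 0 < solveCoupling y := by
  rw [solveCoupling, if_pos hy]; positivity

/-- `y > 0 ⇒ 1/(solveCoupling y)² = y`. [folklore] -/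
theorem inv_sq_solveCoupling {y : ℝ} (hy : 0 < y) : 1 / (solveCoupling y) ^ 2 = y := by
  rw [solveCoupling, if_pos hy, div_pow, one_pow, Real.sq_sqrt hy.le, one_div_one_div]

/-- `y ≤ 0 ⇒ solveCoupling y ≤ 0` (it is `0`). [folklore] -/
theorem solveCoupling_nonpos {y : ℝ} (hy : y ≤ 0) : solveCoupling y ≤ 0 := by
  rw [solveCoupling, if_neg (not_lt.mpr hy)]

/-- The coupling sequence generated forward from `g0` by (0.20) with the history-dependent family `β`
(well-founded recursion: step `k+1` reads the whole prefix `g_0, …, g_k`). [cite: Balaban1987RG1, (0.18)–(0.20) pp.255–256] -/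
def genSeq (β : HBeta) (g0 : ℝ) : ℕ → ℝ
  | 0 => g0
  | k + 1 => solveCoupling (1 / (genSeq β g0 k) ^ 2 - β k (fun i : Fin (k + 1) => genSeq β g0 i))
  decreasing_by all_goals first | exact Nat.lt_succ_self _ | exact Fin.isLt _

/-- Unfolding at `0`. [folklore] -/
theorem genSeq_zero (β : HBeta) (g0 : ℝ) : genSeq β g0 0 = g0 := by
  rw [genSeq]

/-- Unfolding at `k+1`: the next coupling solves (0.20) with the generated prefix. [folklore] -/
theorem genSeq_succ (β : HBeta) (g0 : ℝ) (k : ℕ) :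
    genSeq β g0 (k + 1) = solveCoupling (1 / (genSeq β g0 k) ^ 2 - β k (prefixOf (genSeq β g0) k)) := by
  rw [genSeq]; rfl

/-- The flow data generated by `β` from `g0`: couplings `genSeq`, and run-wise β-functions = `β` curried at the generated
earlier couplings (`Function.update (prefixOf g j) (Fin.last j) x`, the carver's dictionary; `β 0 ·` of the carrier
is unused by (0.20) and set to `0`). [folklore] -/
def genFlow (β : HBeta) (g0 : ℝ) : Flow where
  g := genSeq β g0
  β := fun j x => match j with
    | 0 => 0
    | j + 1 => β j (Function.update (prefixOf (genSeq β g0) j) (Fin.last j) x)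

/-- The canonical construction generated by `β` (all non-flow data trivial: it plays no role on the flow side). [folklore] -/
def modelOf (β : HBeta) : B12.Construction := fun P =>
  { flow := genFlow β P.g0
    Cfg := fun _ => Unit
    dom := fun _ => Set.univ
    effAction := fun _ _ => 0
    wilsonBG := fun _ _ => 0
    Ek := fun _ _ => 0
    numSites := fun _ => 0
    Repr := fun _ => True
    IndAss := fun _ => True }

/-- The canonical construction is forward-generated by (0.20) with `β` (`DagBinding.ForwardGenerated`). [folklore] -/
theorem modelOf_forwardGenerated (β : HBeta) : ForwardGenerated (modelOf β) β := by
  refine ⟨fun P => genSeq_zero β P.g0, fun P k _ _ hrhs => ?_⟩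
  show 0 < genSeq β P.g0 (k + 1) ∧
    1 / (genSeq β P.g0 (k + 1)) ^ 2 = 1 / (genSeq β P.g0 k) ^ 2 - β k (prefixOf (genSeq β P.g0) k)
  rw [genSeq_succ]
  exact ⟨solveCoupling_pos hrhs, inv_sq_solveCoupling hrhs⟩

/-- … halts outside the domain of (0.20) … [folklore] -/
theorem modelOf_haltsOutside (β : HBeta) : HaltsOutside (modelOf β) β := by
  intro P k _ _ hrhs
  show genSeq β P.g0 (k + 1) ≤ 0
  rw [genSeq_succ]
  exact solveCoupling_nonpos hrhs

/-- … and its run-wise β-functions curry `β` (`DagBinding.CurriesHBeta`). [folklore] -/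
theorem modelOf_curries (β : HBeta) : CurriesHBeta (modelOf β) β := fun _ _ _ _ => rfl

/-- NON-VACUITY of §§3–4: for every `β` the three modelling clauses hold simultaneously for `modelOf β`; e.g.
`DagBinding.EndpointExistence (modelOf β)` holds as soon as `β` is continuous with `0 ≤ β ≤ β'` on small boxes —
so everything rests on the box properties of the β-functions (T09.F). [folklore] -/
theorem endpointExistence_modelOf (β : HBeta) {γ₀ β' : ℝ} (hγ₀ : 0 < γ₀) (hβ' : 0 ≤ β')
    (hcont : BetaContH γ₀ β) (hsign : BetaLowerH 0 γ₀ β) (hup : BetaUpperH β' γ₀ β) :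
    EndpointExistence (modelOf β) :=
  endpointExistence_of_forwardGenerated (modelOf β) β hγ₀ hβ' hcont hsign hup (modelOf_forwardGenerated β)

/-- … and `B12.Thm2Printed (modelOf β) L` as soon as, in addition, `β ≥ b > 0` on small boxes: the printed Theorem 2
holds for the canonical construction of ANY such family — i.e. its whole content, at this level of description, is the
pair of box properties (continuity, `0 < b ≤ β ≤ β'`). [folklore] -/
theorem thm2Printed_modelOf (β : HBeta) {L γ₀ b β' : ℝ} (hL : 1 < L) (hγ₀ : 0 < γ₀) (hb : 0 < b)
    (hbβ' : b ≤ β') (hcont : BetaContH γ₀ β) (hlo : BetaLowerH b γ₀ β) (hup : BetaUpperH β' γ₀ β) :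
    B12.Thm2Printed (modelOf β) L :=
  thm2Printed_of_boxBoundsH (modelOf_forwardGenerated β) hL hγ₀ hb hbβ' hcont hlo hup

/-! ## 7. What the endpoint-existence half needs EXACTLY: partial sums of the β's bounded below (v1.2)

The SIGN `β_{k+1} ≥ 0` is sufficient for the endpoint-existence half of Theorem 2 (§3, `DagBinding.
endpointExistence_of_forwardGenerated`) but NOT necessary.  The exact scale of hypothesis is: the partial sums
`Σ_{j∈[k,n)} β_{j+1}(g_0,…,g_j)` along box histories are bounded below by a constant `−M` uniformly in `k ≤ n`
(`BetaPartialSumsLowerH`).  Sufficiency: forward shooting again, with the renormalised coupling taken small relative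
to `M` (`1/g² ≥ 1/γ² + M`).  Necessity: along any realised run in `]0,γ]` ending at `g_K = g` the suffix sums are
`≥ 1/γ² − 1/g²` by telescoping (0.20).  Kernel witness that the sign is not necessary: the alternating family
`betaAlt` (−1, +1, −1, …) has partial sums `≥ −1`, violates the sign at every even step, and its canonical
construction `modelOf betaAlt` satisfies `DagBinding.EndpointExistence`.  (Census refinement of MISSING-B12.md §5 V3:
the end statement's regime hypothesis needs "no drift of Σβ to −∞", not asymptotic freedom; `b > 0` is what the
logarithmic running (0.31) adds.)  Nothing here is a statement about Bałaban's actual β-functions. -/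

/-- Partial sums of the history-dependent β-functions along arbitrary histories in `]0,γ]` are bounded below by `−M`,
uniformly: for every sequence `g` with all `g_i ∈ ]0,γ]` and all `k ≤ n`, `−M ≤ Σ_{j∈[k,n)} β j (g_0,…,g_j)`.  The
cell's typing of the MINIMAL input behind the first sentence of [Balaban1987RG1] Thm 2 (existence of `g₀(ε,g)` with
`g_k ∈ ]0,γ]`, `g_K = g`); a hypothesis, never a fact. [cite: Balaban1987RG1, Thm 2 p.259] -/
def BetaPartialSumsLowerH (M γ : ℝ) (β : HBeta) : Prop :=
  ∀ g : ℕ → ℝ, (∀ i, 0 < g i ∧ g i ≤ γ) → ∀ k n, k ≤ n → -M ≤ ∑ j ∈ Finset.Ico k n, β j (prefixOf g j)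

/-- The sign implies bounded-below partial sums with `M = 0`. [folklore] -/
theorem betaPartialSumsLowerH_of_sign {γ : ℝ} {β : HBeta} (h : BetaLowerH 0 γ β) :
    BetaPartialSumsLowerH 0 γ β := by
  intro g hg k n _
  have hs : 0 ≤ ∑ j ∈ Finset.Ico k n, β j (prefixOf g j) :=
    Finset.sum_nonneg fun j _ => h j _ (mem_box.mpr fun i => hg i)
  simpa using hs

/-- Restriction of the partial-sum bound to a smaller interval. [folklore] -/
theorem betaPartialSumsLowerH_mono {M γ γ' : ℝ} {β : HBeta} (hγ : γ ≤ γ') (h : BetaPartialSumsLowerH M γ' β) :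
    BetaPartialSumsLowerH M γ β :=
  fun g hg k n hkn => h g (fun i => ⟨(hg i).1, (hg i).2.trans hγ⟩) k n hkn

/-- NECESSITY.  Along a solution of the history recursion (0.20) staying in `]0,γ]` up to `K`, every suffix sum of the
β's is `≥ 1/γ² − 1/g_K²` (telescoping): bounded below uniformly in `K` once the endpoint `g_K = g` is prescribed.
So no construction can realise Theorem 2's first sentence unless the β's have bounded-below suffix sums along the
realised histories. [cite: Balaban1987RG1, (0.20) p.256] -/
theorem partialSums_lower_of_run {K : ℕ} {β : HBeta} {g : ℕ → ℝ} {γ : ℝ} (h : RGEqH K β g)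
    (hI : Step.InInterval γ K g) (k : ℕ) (hk : k ≤ K) :
    1 / γ ^ 2 - 1 / (g K) ^ 2 ≤ ∑ j ∈ Finset.Ico k K, β j (prefixOf g j) := by
  have ht := inv_sq_telescopeH h hk le_rfl
  have hk' : 1 / γ ^ 2 ≤ 1 / (g k) ^ 2 :=
    one_div_le_one_div_of_le (pow_pos (hI k hk).1 2) (pow_le_pow_left₀ (hI k hk).1.le (hI k hk).2 2)
  linarith

/-- NECESSITY at the construction level: for a forward-generated construction that halts outside and curries `β`, every
run `⟨K, m, g₀⟩` that stays in `]0,γ]` and ends at `g_K = g` has all suffix sums of its β's `≥ 1/γ² − 1/g²` — so a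
construction satisfying `DagBinding.EndpointExistence` exhibits, for each renormalised `g`, histories along which the
partial sums of `β` are bounded below UNIFORMLY IN `K`. [cite: Balaban1987RG1, Thm 2 p.259 and (0.20) p.256] -/
theorem partialSums_lower_of_endpointRun {C : B12.Construction} {β : HBeta} (hgen : ForwardGenerated C β)
    (hhalt : HaltsOutside C β) (hcur : CurriesHBeta C β) {K m : ℕ} {g0 γ g : ℝ}
    (hI : (C ⟨K, m, g0⟩).flow.InInterval γ K) (hK : (C ⟨K, m, g0⟩).flow.g K = g) (k : ℕ) (hk : k ≤ K) :
    1 / γ ^ 2 - 1 / g ^ 2 ≤ ∑ j ∈ Finset.Ico k K, β j (prefixOf (C ⟨K, m, g0⟩).flow.g j) := by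
  rw [← hK]
  exact partialSums_lower_of_run (rgEqH_of_inInterval hgen hhalt hcur ⟨K, m, g0⟩ hI) hI k hk

/-- The clamped prefix of `FlowStep`'s shooting construction IS the prefix of the clamped run (definitional). [folklore] -/
theorem clampPrefix_eq_prefixOf (β : HBeta) (γ : ℝ) (j : ℕ) (g₀ : ℝ) :
    clampPrefix β γ j g₀ = prefixOf (fun i => gClamp γ (Y β γ i g₀)) j := rfl

/-- SUFFICIENCY — forward shooting under the partial-sum bound.  If `β` is jointly continuous on the boxes
`]0,γ]^{k+1}`, bounded above by `β' ≥ 0` there, and has partial sums `≥ −M` (`M ≥ 0`) along all histories in `]0,γ]`,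
then for every `K` and every renormalised `g` with `1/g² ≥ 1/γ² + M` there is a bare coupling whose forward trajectory
solves (0.20), stays in `]0,γ]`, ends at `g_K = g`, with `1/g² − M ≤ 1/g_k² ≤ 1/g² + β'(K−k)`.  (Same IVT argument as
`FlowStep.couplingTrajectory_exists_hist`; the sign was used there only to keep the clamped run above `1/γ²`, which the
partial-sum bound and the smallness of `g` now guarantee.)  A REDUCTION; no hypothesis is printed except the upper
bound. [cite: Balaban1987RG1, Thm 2 p.259 and (0.20) p.256] -/
theorem couplingTrajectory_exists_partialSums (β : HBeta) {γ M β' : ℝ} (hγ : 0 < γ) (hM : 0 ≤ M)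
    (hβ' : 0 ≤ β') (hcont : BetaContH γ β) (hps : BetaPartialSumsLowerH M γ β) (hhi : BetaUpperH β' γ β) :
    ∀ (K : ℕ) (g : ℝ), 0 < g → 1 / γ ^ 2 + M ≤ 1 / g ^ 2 →
      ∃ gs : ℕ → ℝ, gs K = g ∧ RGEqH K β gs ∧ Step.InInterval γ K gs ∧
        ∀ k, k ≤ K → 1 / g ^ 2 - M ≤ 1 / (gs k) ^ 2 ∧ 1 / (gs k) ^ 2 ≤ 1 / g ^ 2 + β' * ((K : ℝ) - k) := by
  intro K g hg hgM
  have hγg : 1 / γ ^ 2 ≤ 1 / g ^ 2 := by linarith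
  have hgγ : g ≤ γ := by
    have h2 : g ^ 2 ≤ γ ^ 2 := by rwa [one_div_le_one_div (by positivity) (by positivity)] at hγg
    nlinarith [hg, hγ]
  -- partial sums along clamped runs (box histories)
  have hsumlo : ∀ g₀ k n, k ≤ n → -M ≤ ∑ j ∈ Finset.Ico k n, β j (clampPrefix β γ j g₀) := by
    intro g₀ k n hkn
    exact hps (fun i => gClamp γ (Y β γ i g₀)) (fun i => ⟨gClamp_pos hγ _, gClamp_le hγ _⟩) k n hkn
  have hsumhi : ∀ g₀ k n, k ≤ n → ∑ j ∈ Finset.Ico k n, β j (clampPrefix β γ j g₀) ≤ β' * ((n : ℝ) - k) := by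
    intro g₀ k n hkn
    have hcard : ((Finset.Ico k n).card : ℝ) = (n : ℝ) - k := by rw [Nat.card_Ico, Nat.cast_sub hkn]
    have := Finset.sum_le_card_nsmul (Finset.Ico k n) (fun j => β j (clampPrefix β γ j g₀)) β'
      (fun j _ => hhi j _ (clampPrefix_mem_box (β := β) hγ j g₀))
    rw [nsmul_eq_mul, hcard] at this
    linarith
  have hYdiff : ∀ g₀ k n, k ≤ n →
      -M ≤ Y β γ k g₀ - Y β γ n g₀ ∧ Y β γ k g₀ - Y β γ n g₀ ≤ β' * ((n : ℝ) - k) := by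
    intro g₀ k n hkn
    rw [Y_sub_Y hkn]
    exact ⟨hsumlo g₀ k n hkn, hsumhi g₀ k n hkn⟩
  -- the IVT window [g_small, γ], 1/g_small² = 1/g² + β' K
  set A : ℝ := 1 / g ^ 2 + β' * K with hA
  have hApos : 0 < A := by positivity
  set gsm : ℝ := 1 / Real.sqrt A with hgsm
  have hgsm_pos : 0 < gsm := by positivity
  have hgsm_sq : 1 / gsm ^ 2 = A := by
    rw [hgsm, div_pow, one_pow, Real.sq_sqrt hApos.le, one_div_one_div]
  have hgsm_le_g : gsm ≤ g := by
    have h1 : 1 / g ^ 2 ≤ 1 / gsm ^ 2 := by rw [hgsm_sq, hA]; linarith [mul_nonneg hβ' (Nat.cast_nonneg K)]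
    have h2 : gsm ^ 2 ≤ g ^ 2 := by rwa [one_div_le_one_div (by positivity) (by positivity)] at h1
    nlinarith [hgsm_pos, hg]
  have hgsm_le_γ : gsm ≤ γ := hgsm_le_g.trans hgγ
  have hfc : ContinuousOn (Y β γ K) (Set.Icc gsm γ) :=
    (continuousOn_Y hγ hcont K).mono fun x hx => lt_of_lt_of_le hgsm_pos hx.1
  have hfγ : Y β γ K γ ≤ 1 / g ^ 2 := by
    have h := (hYdiff γ 0 K (Nat.zero_le K)).1
    rw [Y_zero] at h
    linarith
  have hfsm : 1 / g ^ 2 ≤ Y β γ K gsm := by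
    have h := (hYdiff gsm 0 K (Nat.zero_le K)).2
    rw [Y_zero, hgsm_sq, hA] at h
    simp only [Nat.cast_zero, sub_zero] at h
    linarith
  obtain ⟨g₀, hg₀mem, hg₀⟩ := intermediate_value_Icc' hgsm_le_γ hfc ⟨hfγ, hfsm⟩
  -- along the chosen run: two-sided control, clamp inactive
  have hYk : ∀ k, k ≤ K → 1 / g ^ 2 - M ≤ Y β γ k g₀ ∧ Y β γ k g₀ ≤ 1 / g ^ 2 + β' * ((K : ℝ) - k) := by
    intro k hk
    have h := hYdiff g₀ k K hk
    rw [hg₀] at h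
    constructor <;> linarith [h.1, h.2]
  have hYge : ∀ k, k ≤ K → 1 / γ ^ 2 ≤ Y β γ k g₀ := fun k hk => by linarith [(hYk k hk).1]
  refine ⟨fun k => gClamp γ (Y β γ k g₀), ?_, ?_, ?_, ?_⟩
  · show gClamp γ (Y β γ K g₀) = g
    rw [gClamp_eq_of_le (hYge K le_rfl), hg₀,
      show (1 : ℝ) / g ^ 2 = (1 / g) ^ 2 by ring, Real.sqrt_sq (by positivity), one_div_one_div]
  · intro k hk
    show 1 / (gClamp γ (Y β γ k g₀)) ^ 2 = 1 / (gClamp γ (Y β γ (k + 1) g₀)) ^ 2 + β k _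
    rw [inv_sq_gClamp hγ (hYge k hk.le), inv_sq_gClamp hγ (hYge (k + 1) hk), Y_succ k g₀]
    have e : prefixOf (fun k => gClamp γ (Y β γ k g₀)) k = fun j : Fin (k + 1) => gClamp γ (Y β γ j g₀) := rfl
    rw [e]
    ring
  · intro k _
    exact ⟨gClamp_pos hγ _, gClamp_le hγ _⟩
  · intro k hk
    show 1 / g ^ 2 - M ≤ 1 / (gClamp γ (Y β γ k g₀)) ^ 2 ∧ 1 / (gClamp γ (Y β γ k g₀)) ^ 2 ≤ 1 / g ^ 2 + β' * ((K : ℝ) - k)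
    rw [inv_sq_gClamp hγ (hYge k hk)]
    exact hYk k hk

/-- **`DagBinding.EndpointExistence` from bounded-below partial sums** (weaker than the sign), for a construction
generated forward by (0.20) with `β`: continuity + upper bound `β'` + partial sums `≥ −M` on the boxes `]0,γ₀]^{k+1}`
⇒ for every `m`, `γ ≤ γ₀`, with `g⋆ = (1/γ² + M)^{−1/2}`, every `g ∈ ]0,g⋆]` and every `K` some bare coupling gives a
run in `]0,γ]` ending at `g_K = g`.  Supersedes §3's sign version in scope (`betaPartialSumsLowerH_of_sign`). [cite: Balaban1987RG1, Thm 2 p.259] -/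
theorem endpointExistence_of_partialSums {C : B12.Construction} {β : HBeta} (hgen : ForwardGenerated C β)
    {γ₀ M β' : ℝ} (hγ₀ : 0 < γ₀) (hM : 0 ≤ M) (hβ' : 0 ≤ β') (hcont : BetaContH γ₀ β)
    (hps : BetaPartialSumsLowerH M γ₀ β) (hhi : BetaUpperH β' γ₀ β) : EndpointExistence C := by
  intro m
  refine ⟨γ₀, hγ₀, fun γ hγ hγle => ?_⟩
  set gstar : ℝ := 1 / Real.sqrt (1 / γ ^ 2 + M) with hgstar
  have hgstar_pos : 0 < gstar := by positivity
  refine ⟨gstar, hgstar_pos, fun g hg hgle K => ?_⟩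
  have hgs : 1 / gstar ^ 2 = 1 / γ ^ 2 + M := by
    rw [hgstar, div_pow, one_pow, Real.sq_sqrt (by positivity), one_div_one_div]
  have hgM : 1 / γ ^ 2 + M ≤ 1 / g ^ 2 := by
    rw [← hgs]
    exact one_div_le_one_div_of_le (by positivity) (pow_le_pow_left₀ hg.le hgle 2)
  have hcont' : BetaContH γ β := fun k => (hcont k).mono (box_mono hγle k)
  have hhi' : BetaUpperH β' γ β := fun k v hv => hhi k v (box_mono hγle k hv)
  obtain ⟨gs, hgsK, hrg, hI, -⟩ := couplingTrajectory_exists_partialSums β hγ hM hβ' hcont'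
    (betaPartialSumsLowerH_mono hγle hps) hhi' K g hg hgM
  have heq : ∀ k, k ≤ K → (C ⟨K, m, gs 0⟩).flow.g k = gs k :=
    flow_eq_of_rgEqH (C ⟨K, m, gs 0⟩).flow β K (fun k hk => hgen.2 ⟨K, m, gs 0⟩ k hk)
      (hgen.1 ⟨K, m, gs 0⟩) hrg (fun k hk => (hI k hk).1)
  refine ⟨gs 0, fun k hk => ?_, ?_⟩
  · rw [heq k hk]; exact hI k hk
  · rw [heq K le_rfl]; exact hgsK

/-- The alternating family `β_{k+1} ≡ −1` (k even), `+1` (k odd) — history-independent, continuous, `≤ 1`, of NO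
definite sign. [folklore] -/
def betaAlt : HBeta := fun k _ => if Even k then -1 else 1

/-- Each value of `betaAlt` is a difference of consecutive parity indicators. [folklore] -/
theorem betaAlt_eq (n : ℕ) (v : Fin (n + 1) → ℝ) :
    betaAlt n v = (if Even n then (0 : ℝ) else 1) - (if Even (n + 1) then (0 : ℝ) else 1) := by
  unfold betaAlt
  rcases Nat.even_or_odd n with h | h
  · have h' : ¬ Even (n + 1) := fun h1 => (Nat.even_add_one.mp h1) h
    norm_num [h, h']
  · have h1 : ¬ Even n := Nat.not_even_iff_odd.mpr h
    have h2 : Even (n + 1) := Nat.even_add_one.mpr h1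
    norm_num [h1, h2]

/-- Its partial sums telescope to a difference of parity indicators. [folklore] -/
theorem betaAlt_sum (g : ℕ → ℝ) (k n : ℕ) (hkn : k ≤ n) :
    ∑ j ∈ Finset.Ico k n, betaAlt j (prefixOf g j) =
      (if Even k then (0 : ℝ) else 1) - (if Even n then (0 : ℝ) else 1) := by
  induction n, hkn using Nat.le_induction with
  | base => simp
  | succ n hkn ih =>
    rw [Finset.sum_Ico_succ_top hkn, ih, betaAlt_eq]
    ring

/-- … hence are `≥ −1` along every history. [folklore] -/
theorem betaAlt_partialSumsLower (γ : ℝ) : BetaPartialSumsLowerH 1 γ betaAlt := by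
  intro g _ k n hkn
  rw [betaAlt_sum g k n hkn]
  split_ifs <;> norm_num

/-- `betaAlt` is continuous on every box (constant in the history). [folklore] -/
theorem betaAlt_cont (γ : ℝ) : BetaContH γ betaAlt := fun _ => continuousOn_const

/-- `betaAlt ≤ 1`. [folklore] -/
theorem betaAlt_upper (γ : ℝ) : BetaUpperH 1 γ betaAlt := fun k v _ => by
  unfold betaAlt; split_ifs <;> norm_num

/-- `betaAlt` violates the sign on every box (already at step 0). [folklore] -/
theorem betaAlt_not_sign {γ : ℝ} (hγ : 0 < γ) : ¬ BetaLowerH 0 γ betaAlt := by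
  intro h
  have := h 0 (fun _ => γ) (mem_box.mpr fun _ => ⟨hγ, le_rfl⟩)
  norm_num [betaAlt] at this

/-- **The sign is NOT necessary for the endpoint-existence half of Theorem 2** (kernel witness): a β-family of no
definite sign whose canonical forward-generated construction nevertheless satisfies `DagBinding.EndpointExistence`
— because its partial sums are bounded below.  So the exact analytic content of Thm 2's first sentence, at the level
of box properties, is `BetaPartialSumsLowerH` (sufficient: `endpointExistence_of_partialSums`; necessary along runs:
`partialSums_lower_of_run`), strictly weaker than (A-sign) of the cell's census. [folklore] -/
theorem sign_not_necessary :
    ∃ β : HBeta, (∀ γ : ℝ, 0 < γ → ¬ BetaLowerH 0 γ β) ∧ EndpointExistence (modelOf β) :=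
  ⟨betaAlt, fun _ hγ => betaAlt_not_sign hγ,
    endpointExistence_of_partialSums (modelOf_forwardGenerated betaAlt) one_pos zero_le_one zero_le_one
      (betaAlt_cont 1) (betaAlt_partialSumsLower 1) (betaAlt_upper 1)⟩

/-! ## 8. The p. 355 unconditional reading needs only the endpoint-existence half — hence only (A-ps) (v1.3)

[Balaban1989LargeFieldII] p. 355: "Theorem 2 of [I] allows us to remove the assumption on the effective coupling
constants in the above theorem".  In the kernel this removal (`B16.Sect2Unconditional`, and the unconditional form
of (0.1)) consumes ONLY the first sentence of [I] Thm 2 (endpoint existence) — `B16.sect2_unconditional_of_Thm2`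
discards (0.31) — and the flow inequality (2.6) of [Balaban1988Convergent] along in-interval runs consumes only a
partial-sum lower bound (strat-b14's `B14FlowStep.flow26d_of_partialSum_ge`).  Hence the whole flow side of the
cell's end statement, INCLUDING the p. 355 unconditional reading, rests on `BetaPartialSumsLowerH` (+ continuity +
the printed upper bound + an explicit smallness of γ), not on asymptotic freedom `b > 0`, which only (0.31) itself
and (2.46) of [Balaban1988Convergent] consume.  Bookkeeping only. -/

/-- `B16.Sect2Unconditional` from [III] Thm 1 (conditional) + the endpoint-existence half alone ((0.31) is not
used; cf. `B16.sect2_unconditional_of_Thm2`). [cite: Balaban1989LargeFieldII, p.355] -/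
theorem sect2Unconditional_of_endpoint (C : B16.Construction) (h1 : B16.Thm1Printed C)
    (hex : EndpointExistence C.toB12) : B16.Sect2Unconditional C := by
  obtain ⟨γ₁, hγ₁, H1⟩ := h1
  intro m
  obtain ⟨γ₂, hγ₂, H2⟩ := hex m
  obtain ⟨gstar, hgstar, Hg⟩ := H2 (min γ₁ γ₂) (lt_min hγ₁ hγ₂) (min_le_right _ _)
  refine ⟨gstar, hgstar, fun g hg hgle K => ?_⟩
  obtain ⟨g0, hint, hgK⟩ := Hg g hg hgle K
  refine ⟨g0, hgK, fun k hk => H1 ⟨K, m, g0⟩ ?_ k hk⟩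
  intro j hj
  obtain ⟨hpos, hle⟩ := hint j hj
  exact ⟨hpos, le_trans hle (min_le_left _ _)⟩

/-- The unconditional form of (0.1) from `B16.UVBound01` (conditional) + the endpoint-existence half alone
(cf. `B16.uv_unconditional_of_Thm2`). [cite: Balaban1989LargeFieldII, (0.1) pp.355–356] -/
theorem uvUnconditional_of_endpoint (C : B16.Construction) (h01 : B16.UVBound01 C)
    (hex : EndpointExistence C.toB12) :
    ∃ Em Ep : ℝ, ∀ m : ℕ, ∃ gstar : ℝ, 0 < gstar ∧ ∀ g : ℝ, 0 < g → g ≤ gstar →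
      ∀ K : ℕ, ∃ g0 : ℝ, (C ⟨K, m, g0⟩).flow.g K = g ∧
        ∀ k, k ≤ K → ∀ V : (C ⟨K, m, g0⟩).Cfg k, B16.UVIneq (C ⟨K, m, g0⟩) k V Em Ep := by
  obtain ⟨γ₁, hγ₁, Em, Ep, H1⟩ := h01
  refine ⟨Em, Ep, fun m => ?_⟩
  obtain ⟨γ₂, hγ₂, H2⟩ := hex m
  obtain ⟨gstar, hgstar, Hg⟩ := H2 (min γ₁ γ₂) (lt_min hγ₁ hγ₂) (min_le_right _ _)
  refine ⟨gstar, hgstar, fun g hg hgle K => ?_⟩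
  obtain ⟨g0, hint, hgK⟩ := Hg g hg hgle K
  refine ⟨g0, hgK, fun k hk V => H1 ⟨K, m, g0⟩ ?_ k hk V⟩
  intro j hj
  obtain ⟨hpos, hle⟩ := hint j hj
  exact ⟨hpos, le_trans hle (min_le_left _ _)⟩

/-- (2.6) of [Balaban1988Convergent] p. 255 ALONG ONE RUN from: (0.20), couplings in `]0,γ]`, `β_{j+1}(g_j) ≤ β′`
(`β′ ≥ 0`), partial sums `Σ_{j∈[m,n)} β_{j+1}(g_j) ≥ −B` and the smallness `Bγ² ≤ β₀(2+β₀)` — first member by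
`B14.flow26_upper_of_rg`, last member by strat-b14's `B14FlowStep.flow26d_of_partialSum_ge`.  No sign of β. [cite: Balaban1988Convergent, (2.6) p.255] -/
theorem flowIneq26_of_partialSums_along (F : Flow) (K : ℕ) {γ β' β₀ B : ℝ} (hβ' : 0 ≤ β') (hβ₀ : 0 ≤ β₀)
    (hI : F.InInterval γ K) (hrg : F.SatisfiesRG K) (hub : ∀ j, j < K → F.β (j + 1) (F.g j) ≤ β')
    (hps : ∀ m n, m ≤ n → n ≤ K → -B ≤ ∑ j ∈ Finset.Ico m n, F.β (j + 1) (F.g j))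
    (hB : B * γ ^ 2 ≤ β₀ * (2 + β₀)) : B14.FlowIneq26 F.g β' β₀ K := by
  have hpos : ∀ j, j ≤ K → 0 < F.g j := fun j hj => (hI j hj).1
  have hB0 : 0 ≤ B := by
    have h := hps 0 0 le_rfl (Nat.zero_le K)
    simp at h
    linarith
  intro m n hmn hnK
  refine ⟨B14.flow26_upper_of_rg F K β' hβ' hpos hrg hub m n hmn hnK, ?_⟩
  have hgm : F.g m ≤ γ := (hI m (hmn.le.trans hnK)).2
  have hBm : B * (F.g m) ^ 2 ≤ β₀ * (2 + β₀) := by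
    have h2 : (F.g m) ^ 2 ≤ γ ^ 2 := pow_le_pow_left₀ (hpos m (hmn.le.trans hnK)).le hgm 2
    nlinarith
  exact B14FlowStep.flow26d_of_partialSum_ge F K hβ₀ hpos hrg hmn.le hnK (hps m n hmn.le hnK) hBm

/-- **(B) (`B16.EndStatementB`, conditional form) from the thirteen nodes and (A-ps).**  For a world `w`
(`0 < γ ≤ γ₀`, `β⁺ ≥ 0`) whose construction is forward-generated by (0.20) with a curried family `β` and halts
outside: if `β ≤ β⁺` on the boxes `]0,γ₀]^{k+1}` (printed, p. 264) and the partial sums of `β` along box histories are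
`≥ −M` with `Mγ² ≤ β₀(2+β₀)`, then along every in-interval run (0.20) holds (`satisfiesRG_of_inInterval`) and (2.6)
follows (`flowIneq26_of_partialSums_along`), so the DAG yields (B).  Neither the sign of β nor `b > 0` is used (the
world's `b` is not referenced). [cite: Balaban1989LargeFieldII, Thm 1 + (0.1) pp.355–356] -/
theorem endStatementB_of_nodes_partialSums (w : World) (hγ : 0 < w.γ) {γ₀ M : ℝ} (hγ₀ : w.γ ≤ γ₀)
    (hβup : 0 ≤ w.βup) (hMγ : M * w.γ ^ 2 ≤ w.β₀ * (2 + w.β₀))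
    (hnodes : ∀ P, Nodes (leaves w P)) {β : HBeta} (hgen : ForwardGenerated w.C.toB12 β)
    (hhalt : HaltsOutside w.C.toB12 β) (hcur : CurriesHBeta w.C.toB12 β)
    (hps : BetaPartialSumsLowerH M γ₀ β) (hup : BetaUpperH w.βup γ₀ β) : B16.EndStatementB w.C := by
  refine endStatementB_of_worlds w hγ fun P => uvStability_of_nodes _ (hnodes P) ?_
  intro hsc
  have hrg : (w.C P).flow.SatisfiesRG P.K := satisfiesRG_of_inInterval hgen hhalt hcur P hsc
  have hpt : ∀ j, j < P.K →
      (w.C P).flow.β (j + 1) ((w.C P).flow.g j) = β j (prefixOf (w.C P).flow.g j) := by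
    intro j hj
    have h := hcur P j ((w.C.toB12 P).flow.g j) hj
    rw [update_prefixOf_last] at h
    exact h
  have hbox : ∀ j, j < P.K → prefixOf (w.C P).flow.g j ∈ Box γ₀ j := fun j hj =>
    mem_box.mpr fun i => by
      have hi : (i : ℕ) ≤ P.K := by have := i.isLt; omega
      exact ⟨(hsc i hi).1, (hsc i hi).2.trans hγ₀⟩
  have hub : ∀ j, j < P.K → (w.C P).flow.β (j + 1) ((w.C P).flow.g j) ≤ w.βup := fun j hj => by
    rw [hpt j hj]; exact hup j _ (hbox j hj)
  have hps' : ∀ m n, m ≤ n → n ≤ P.K →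
      -M ≤ ∑ j ∈ Finset.Ico m n, (w.C P).flow.β (j + 1) ((w.C P).flow.g j) := by
    intro m n hmn hnK
    -- extend the run beyond K to an infinite history inside the box
    let g' : ℕ → ℝ := fun i => if i ≤ P.K then (w.C P).flow.g i else w.γ
    have hg'box : ∀ i, 0 < g' i ∧ g' i ≤ γ₀ := by
      intro i
      by_cases hi : i ≤ P.K
      · simp only [g', hi, if_true]; exact ⟨(hsc i hi).1, (hsc i hi).2.trans hγ₀⟩
      · simp only [g', hi, if_false]; exact ⟨hγ, hγ₀⟩
    have hpre : ∀ j, j < P.K → prefixOf g' j = prefixOf (w.C P).flow.g j := by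
      intro j hj
      funext i
      have hi : (i : ℕ) ≤ P.K := by have := i.isLt; omega
      simp [prefixOf, g', hi]
    have hsum : ∑ j ∈ Finset.Ico m n, β j (prefixOf g' j) =
        ∑ j ∈ Finset.Ico m n, (w.C P).flow.β (j + 1) ((w.C P).flow.g j) := by
      refine Finset.sum_congr rfl fun j hj => ?_
      have hjK : j < P.K := lt_of_lt_of_le (Finset.mem_Ico.mp hj).2 hnK
      rw [hpre j hjK, hpt j hjK]
    have h := hps g' hg'box m n hmn
    rw [hsum] at h
    exact h
  exact flowIneq26_of_partialSums_along (w.C P).flow P.K hβup w.β₀_pos.le hsc hrg hub hps' hMγ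

/-- **HEADLINE (v1.3): the p. 355 unconditional reading from (A-ps).**  For a world `w` as above with, in addition,
`β` jointly continuous on the boxes and `M ≥ 0`: the thirteen paper nodes + the three modelling clauses + [continuity,
`β ≤ β⁺`, partial sums `≥ −M` on `]0,γ₀]^{k+1}`, `Mγ² ≤ β₀(2+β₀)`] ⇒ `B16.Sect2Unconditional w.C` ∧ the unconditional
form of (0.1) — i.e. exactly what [Balaban1989LargeFieldII] p. 355 says Theorem 2 of [I] delivers, obtained WITHOUT
the sign of the β-functions, without `b > 0` and without (0.31).  The located unprinted input of the flow side is
thereby reduced to (A-ps) (cell MISSING-B12.md §8.5); (0.31)/(2.46) still need `b > 0` (§3, `FlowStep`).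
Bookkeeping only; nothing of the series is asserted. [cite: Balaban1989LargeFieldII, p.355] -/
theorem p355Unconditional_of_partialSums (w : World) (hγ : 0 < w.γ) {γ₀ M : ℝ} (hγ₀ : w.γ ≤ γ₀) (hM : 0 ≤ M)
    (hβup : 0 ≤ w.βup) (hMγ : M * w.γ ^ 2 ≤ w.β₀ * (2 + w.β₀))
    (hnodes : ∀ P, Nodes (leaves w P)) {β : HBeta} (hgen : ForwardGenerated w.C.toB12 β)
    (hhalt : HaltsOutside w.C.toB12 β) (hcur : CurriesHBeta w.C.toB12 β) (hcont : BetaContH γ₀ β)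
    (hps : BetaPartialSumsLowerH M γ₀ β) (hup : BetaUpperH w.βup γ₀ β) :
    B16.Sect2Unconditional w.C ∧
      ∃ Em Ep : ℝ, ∀ m : ℕ, ∃ gstar : ℝ, 0 < gstar ∧ ∀ g : ℝ, 0 < g → g ≤ gstar →
        ∀ K : ℕ, ∃ g0 : ℝ, (w.C ⟨K, m, g0⟩).flow.g K = g ∧
          ∀ k, k ≤ K → ∀ V : (w.C ⟨K, m, g0⟩).Cfg k, B16.UVIneq (w.C ⟨K, m, g0⟩) k V Em Ep := by
  have hB : B16.EndStatementB w.C :=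
    endStatementB_of_nodes_partialSums w hγ hγ₀ hβup hMγ hnodes hgen hhalt hcur hps hup
  have hex : EndpointExistence w.C.toB12 :=
    endpointExistence_of_partialSums hgen (lt_of_lt_of_le hγ hγ₀) hM hβup hcont hps hup
  exact ⟨sect2Unconditional_of_endpoint w.C hB.1 hex, uvUnconditional_of_endpoint w.C hB.2 hex⟩

/-! ## 9. What the PRINTED two-sided bound alone gives: bare couplings for each FIXED `K` (ε-dependent smallness of `g`) — the gap is the quantifier swap (v1.4)

With only the printed property `|β_{j+1}| ≤ β′` (p. 264 "uniformly bounded"; §5 via (5.10)) and joint continuity, the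
suffix sums over `[k, K)` are `≥ −β′K`: bounded below for each FIXED number of steps `K`.  The shooting argument then
yields, for each `K` separately, a bare coupling with `g_K = g` and `g_k ∈ ]0,γ]` PROVIDED `1/g² ≥ 1/γ² + β′K`, i.e.
`g ≤ g⋆(K) = (1/γ² + β′K)^{−1/2} → 0` as `K → ∞` (`ε = L^{−K} → 0`).  Theorem 2's first sentence asserts `g⋆` INDEPENDENT
of `K` ("for a sufficiently small positive g there exists … g₀(ε, g)", for every ε).  So, modulo continuity, the
located unprinted input (A-ps) is EXACTLY the uniformity in `K` that turns `∀ K ∃ g⋆(K)` (a consequence of printed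
material, below) into `∃ g⋆ ∀ K` (Theorem 2).  Bookkeeping only. -/

/-- Suffix sums over `[k, K)` bounded below by `−M` along all histories in `]0,γ]`, for ONE horizon `K` (the K-local
form of `BetaPartialSumsLowerH`; here `M` may depend on `K`). [folklore] -/
def BetaSuffixSumsLowerK (M γ : ℝ) (β : HBeta) (K : ℕ) : Prop :=
  ∀ g : ℕ → ℝ, (∀ i, 0 < g i ∧ g i ≤ γ) → ∀ k, k ≤ K → -M ≤ ∑ j ∈ Finset.Ico k K, β j (prefixOf g j)

/-- The global partial-sum bound gives the K-local one for every `K` (same `M`). [folklore] -/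
theorem betaSuffixSumsLowerK_of_partialSums {M γ : ℝ} {β : HBeta} (h : BetaPartialSumsLowerH M γ β) (K : ℕ) :
    BetaSuffixSumsLowerK M γ β K := fun g hg k hk => h g hg k K hk

/-- **From the PRINTED two-sided bound alone**: `−β′ ≤ β_{j+1}` on the boxes (`β′ ≥ 0`) gives the K-local suffix bound
with the K-DEPENDENT constant `M = β′K`. [cite: Balaban1987RG1, §1 p.264] -/
theorem betaSuffixSumsLowerK_of_abs {γ β' : ℝ} {β : HBeta} (hβ' : 0 ≤ β') (hlo : BetaLowerH (-β') γ β) (K : ℕ) :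
    BetaSuffixSumsLowerK (β' * K) γ β K := by
  intro g hg k hk
  have hcard : ((Finset.Ico k K).card : ℝ) = (K : ℝ) - k := by rw [Nat.card_Ico, Nat.cast_sub hk]
  have h := Finset.card_nsmul_le_sum (Finset.Ico k K) (fun j => β j (prefixOf g j)) (-β')
    (fun j _ => hlo j _ (mem_box.mpr fun i => hg i))
  rw [nsmul_eq_mul, hcard] at h
  have hk0 : 0 ≤ β' * (k : ℝ) := mul_nonneg hβ' (Nat.cast_nonneg k)
  linarith

/-- SHOOTING WITH A K-LOCAL SUFFIX BOUND (the proof of `couplingTrajectory_exists_partialSums` uses the lower bound only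
for suffix sums ending at `K`): continuity + `β ≤ β′` (`β′ ≥ 0`) + suffix sums over `[k,K)` `≥ −M` (`M ≥ 0`) along box
histories ⇒ for every `g` with `1/g² ≥ 1/γ² + M` a bare coupling whose forward trajectory solves (0.20), stays in
`]0,γ]`, ends at `g_K = g`. [cite: Balaban1987RG1, Thm 2 p.259 and (0.20) p.256] -/
theorem couplingTrajectory_exists_suffixK (β : HBeta) {γ M β' : ℝ} (hγ : 0 < γ) (hM : 0 ≤ M) (hβ' : 0 ≤ β')
    (hcont : BetaContH γ β) (K : ℕ) (hps : BetaSuffixSumsLowerK M γ β K) (hhi : BetaUpperH β' γ β) :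
    ∀ g : ℝ, 0 < g → 1 / γ ^ 2 + M ≤ 1 / g ^ 2 →
      ∃ gs : ℕ → ℝ, gs K = g ∧ RGEqH K β gs ∧ Step.InInterval γ K gs := by
  intro g hg hgM
  have hγg : 1 / γ ^ 2 ≤ 1 / g ^ 2 := by linarith
  have hgγ : g ≤ γ := by
    have h2 : g ^ 2 ≤ γ ^ 2 := by rwa [one_div_le_one_div (by positivity) (by positivity)] at hγg
    nlinarith [hg, hγ]
  have hsumlo : ∀ g₀ k, k ≤ K → -M ≤ ∑ j ∈ Finset.Ico k K, β j (clampPrefix β γ j g₀) := by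
    intro g₀ k hk
    exact hps (fun i => gClamp γ (Y β γ i g₀)) (fun i => ⟨gClamp_pos hγ _, gClamp_le hγ _⟩) k hk
  have hsumhi : ∀ g₀ k n, k ≤ n → ∑ j ∈ Finset.Ico k n, β j (clampPrefix β γ j g₀) ≤ β' * ((n : ℝ) - k) := by
    intro g₀ k n hkn
    have hcard : ((Finset.Ico k n).card : ℝ) = (n : ℝ) - k := by rw [Nat.card_Ico, Nat.cast_sub hkn]
    have := Finset.sum_le_card_nsmul (Finset.Ico k n) (fun j => β j (clampPrefix β γ j g₀)) β'
      (fun j _ => hhi j _ (clampPrefix_mem_box (β := β) hγ j g₀))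
    rw [nsmul_eq_mul, hcard] at this
    linarith
  have hYlo : ∀ g₀ k, k ≤ K → -M ≤ Y β γ k g₀ - Y β γ K g₀ := by
    intro g₀ k hk
    rw [Y_sub_Y hk]
    exact hsumlo g₀ k hk
  have hYhi : ∀ g₀ k n, k ≤ n → Y β γ k g₀ - Y β γ n g₀ ≤ β' * ((n : ℝ) - k) := by
    intro g₀ k n hkn
    rw [Y_sub_Y hkn]
    exact hsumhi g₀ k n hkn
  set A : ℝ := 1 / g ^ 2 + β' * K with hA
  have hApos : 0 < A := by positivity
  set gsm : ℝ := 1 / Real.sqrt A with hgsm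
  have hgsm_pos : 0 < gsm := by positivity
  have hgsm_sq : 1 / gsm ^ 2 = A := by
    rw [hgsm, div_pow, one_pow, Real.sq_sqrt hApos.le, one_div_one_div]
  have hgsm_le_g : gsm ≤ g := by
    have h1 : 1 / g ^ 2 ≤ 1 / gsm ^ 2 := by rw [hgsm_sq, hA]; linarith [mul_nonneg hβ' (Nat.cast_nonneg K)]
    have h2 : gsm ^ 2 ≤ g ^ 2 := by rwa [one_div_le_one_div (by positivity) (by positivity)] at h1
    nlinarith [hgsm_pos, hg]
  have hgsm_le_γ : gsm ≤ γ := hgsm_le_g.trans hgγ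
  have hfc : ContinuousOn (Y β γ K) (Set.Icc gsm γ) :=
    (continuousOn_Y hγ hcont K).mono fun x hx => lt_of_lt_of_le hgsm_pos hx.1
  have hfγ : Y β γ K γ ≤ 1 / g ^ 2 := by
    have h := hYlo γ 0 (Nat.zero_le K)
    rw [Y_zero] at h
    linarith
  have hfsm : 1 / g ^ 2 ≤ Y β γ K gsm := by
    have h := hYhi gsm 0 K (Nat.zero_le K)
    rw [Y_zero, hgsm_sq, hA] at h
    simp only [Nat.cast_zero, sub_zero] at h
    linarith
  obtain ⟨g₀, hg₀mem, hg₀⟩ := intermediate_value_Icc' hgsm_le_γ hfc ⟨hfγ, hfsm⟩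
  have hYge : ∀ k, k ≤ K → 1 / γ ^ 2 ≤ Y β γ k g₀ := by
    intro k hk
    have h := hYlo g₀ k hk
    rw [hg₀] at h
    linarith
  refine ⟨fun k => gClamp γ (Y β γ k g₀), ?_, ?_, ?_⟩
  · show gClamp γ (Y β γ K g₀) = g
    rw [gClamp_eq_of_le (hYge K le_rfl), hg₀,
      show (1 : ℝ) / g ^ 2 = (1 / g) ^ 2 by ring, Real.sqrt_sq (by positivity), one_div_one_div]
  · intro k hk
    show 1 / (gClamp γ (Y β γ k g₀)) ^ 2 = 1 / (gClamp γ (Y β γ (k + 1) g₀)) ^ 2 + β k _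
    rw [inv_sq_gClamp hγ (hYge k hk.le), inv_sq_gClamp hγ (hYge (k + 1) hk), Y_succ k g₀]
    have e : prefixOf (fun k => gClamp γ (Y β γ k g₀)) k = fun j : Fin (k + 1) => gClamp γ (Y β γ j g₀) := rfl
    rw [e]
    ring
  · intro k _
    exact ⟨gClamp_pos hγ _, gClamp_le hγ _⟩

/-- **What the printed material gives, per ε.**  From the PRINTED two-sided bound `|β_{j+1}| ≤ β′` on the boxes
(p. 264; (5.10)+(5.42), §5) and joint continuity (asserted p. 264): for EVERY FIXED `K` (ε = L^{−K}) and every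
renormalised `g` with `1/g² ≥ 1/γ² + β′K` — i.e. `g ≤ (1/γ² + β′K)^{−1/2}`, a bound SHRINKING TO 0 as ε → 0 — there is a
bare coupling whose trajectory stays in `]0,γ]` and ends at `g_K = g`.  Theorem 2 asserts the same with `g` small
INDEPENDENTLY of ε; the difference is exactly the K-uniformity of the suffix-sum bound (A-ps).  (Continuity remains an
unprinted input, GAPS G-adv2-3, G-adv2-6.) [cite: Balaban1987RG1, Thm 2 p.259 and §1 p.264] -/
theorem endpoint_fixedK_of_absBound (β : HBeta) {γ β' : ℝ} (hγ : 0 < γ) (hβ' : 0 ≤ β')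
    (hcont : BetaContH γ β) (hlo : BetaLowerH (-β') γ β) (hhi : BetaUpperH β' γ β) (K : ℕ) :
    ∀ g : ℝ, 0 < g → 1 / γ ^ 2 + β' * K ≤ 1 / g ^ 2 →
      ∃ gs : ℕ → ℝ, gs K = g ∧ RGEqH K β gs ∧ Step.InInterval γ K gs :=
  couplingTrajectory_exists_suffixK β hγ (mul_nonneg hβ' (Nat.cast_nonneg K)) hβ' hcont K
    (betaSuffixSumsLowerK_of_abs hβ' hlo K) hhi

/-- The same at the construction level: for a construction generated forward by (0.20) whose β-family is continuous
with `|β| ≤ β′` on `]0,γ₀]^{k+1}` — e.g. `β′ = β′₅.₁₀` from (5.10), `betaBoundsH_of_decay510` — for every `m`, `γ ≤ γ₀`,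
every `K` and every `g ≤ (1/γ² + β′K)^{−1/2}` some bare coupling gives a run in `]0,γ]` ending at `g_K = g`.  Compare
`DagBinding.EndpointExistence` (= the same with `g⋆` BEFORE `∀ K`): the printed inputs give the K-DEPENDENT version
only. [cite: Balaban1987RG1, Thm 2 p.259 and (5.10) p.293] -/
theorem endpointK_of_absBound {C : B12.Construction} {β : HBeta} (hgen : ForwardGenerated C β) {γ₀ β' : ℝ}
    (hβ' : 0 ≤ β') (hcont : BetaContH γ₀ β) (hlo : BetaLowerH (-β') γ₀ β) (hhi : BetaUpperH β' γ₀ β)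
    (m : ℕ) {γ : ℝ} (hγ : 0 < γ) (hγle : γ ≤ γ₀) (K : ℕ) {g : ℝ} (hg : 0 < g)
    (hgK : 1 / γ ^ 2 + β' * K ≤ 1 / g ^ 2) :
    ∃ g0 : ℝ, (C ⟨K, m, g0⟩).flow.InInterval γ K ∧ (C ⟨K, m, g0⟩).flow.g K = g := by
  have hcont' : BetaContH γ β := fun k => (hcont k).mono (box_mono hγle k)
  have hlo' : BetaLowerH (-β') γ β := fun k v hv => hlo k v (box_mono hγle k hv)
  have hhi' : BetaUpperH β' γ β := fun k v hv => hhi k v (box_mono hγle k hv)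
  obtain ⟨gs, hgsK, hrg, hI⟩ := endpoint_fixedK_of_absBound β hγ hβ' hcont' hlo' hhi' K g hg hgK
  have heq : ∀ k, k ≤ K → (C ⟨K, m, gs 0⟩).flow.g k = gs k :=
    flow_eq_of_rgEqH (C ⟨K, m, gs 0⟩).flow β K (fun k hk => hgen.2 ⟨K, m, gs 0⟩ k hk)
      (hgen.1 ⟨K, m, gs 0⟩) hrg (fun k hk => (hI k hk).1)
  refine ⟨gs 0, fun k hk => ?_, ?_⟩
  · rw [heq k hk]; exact hI k hk
  · rw [heq K le_rfl]; exact hgsK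

/-- … and with the bound supplied by (5.10) itself (sub-cell B12's `Decay510` kernels, `betaBoundsH_of_decay510`): the
ε-dependent endpoint statement follows from (5.42)+(5.10) + continuity + forward generation — every input printed
except continuity (and (5.10) itself — stated on p. 293 as what "the representation (4.37) yields", no derivation printed, GAPS G-B12s-15). [cite: Balaban1987RG1, (5.10) p.293 and Thm 2 p.259] -/
theorem endpointK_of_decay510 {C : B12.Construction} {β : HBeta} (hgen : ForwardGenerated C β)
    {d : ℕ} (μ ν : Fin d) (PfamH : (k : ℕ) → (Fin (k + 1) → ℝ) → B12Beta.Kernel d) {γ₀ Cst δ₁ : ℝ}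
    (hγ₀ : 0 < γ₀) (hδ : 0 < δ₁) (hβ : ∀ k v, β k v = B12Beta.secondMoment (PfamH k v) μ ν)
    (hdec : ∀ k v, v ∈ Box γ₀ k → B12Sec2to5.Decay510 (PfamH k v μ ν) Cst δ₁)
    (hcont : BetaContH γ₀ β) (m : ℕ) {γ : ℝ} (hγ : 0 < γ) (hγle : γ ≤ γ₀) (K : ℕ) {g : ℝ} (hg : 0 < g)
    (hgK : 1 / γ ^ 2 + B12Sec2to5.betaPrime510 d Cst δ₁ * K ≤ 1 / g ^ 2) :
    ∃ g0 : ℝ, (C ⟨K, m, g0⟩).flow.InInterval γ K ∧ (C ⟨K, m, g0⟩).flow.g K = g := by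
  obtain ⟨hup, hlo⟩ := betaBoundsH_of_decay510 μ ν PfamH β hδ hβ hdec
  have hmem : (fun _ : Fin (0 + 1) => γ₀) ∈ Box γ₀ 0 := mem_box.mpr fun _ => ⟨hγ₀, le_rfl⟩
  have hβ' : 0 ≤ B12Sec2to5.betaPrime510 d Cst δ₁ := by
    have h1 := hlo 0 _ hmem
    have h2 := hup 0 _ hmem
    linarith
  exact endpointK_of_absBound hgen hβ' hcont hlo hup m hγ hγle K hg hgK


/-! ## 10. The one-loop LIMIT form of the input: (AF-0∞) + (AF-0r) + (AF-1) ⇒ (A-ps), no small-k sign needed (v1.5)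

Cell HOME/BETA/OBJECTS.md §2–§4: in the printed split `β_{k+1} = β⁰_{k+1} + β¹_{k+1}` ((1.3)/(1.6), (2.12)–(2.14)) the
one-loop coefficient `β⁰_{k+1}` is a Gaussian quantity (the polarization of `log Z^{(k)}`, (1.4)) that depends on the
scale k through the fine lattice `η = L^{−k}`; what the analysis rows of the β sub-cell can hope to prove is a LIMIT
statement — `β⁰_{k+1} → β⁰_∞` at a geometric rate `|β⁰_{k+1} − β⁰_∞| ≤ c₀θ^k` — together with the remainder bound
(AF-1) `|β¹_{k+1}| ≤ C g_k`.  This section records, as kernel bookkeeping, that these give the EXACT endpoint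
hypothesis (A-ps) of §7 with `M = c₀/(1−θ)` whenever `Cγ ≤ β⁰_∞`, without any hypothesis on the signs of the finitely
many small-k coefficients; that `β_{k+1} ≥ β⁰_∞/2` from an explicit `k₀` on; and that Theorem 2 with (0.31) for ALL
k needs in addition exactly the finite list `β⁰_{k+1} ≥ 3β⁰_∞/4, k < k₀`.  Nothing here is a statement about
Bałaban's actual β-functions: (AF-0∞), (AF-0r), (AF-1) are located UNPRINTED inputs (cell MISSING-B12.md (M1)/(M2)). -/

/-- Box histories are `B12Beta.HistBox` histories (the two cells' typings agree pointwise). [folklore] -/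
theorem histBox_of_mem_box {γ : ℝ} {k : ℕ} {v : Fin (k + 1) → ℝ} (hv : v ∈ Box γ k) :
    v ∈ B12Beta.HistBox γ k := fun i => mem_box.mp hv i

/-- One step of the limit form: geometric convergence of the one-loop coefficients to `β⁰_∞`, the remainder bound
(AF-1) and `Cγ ≤ β⁰_∞` give `β_{k+1}(g_0,…,g_k) ≥ −c₀θ^k` on histories in ]0,γ]. [folklore] -/
theorem beta_ge_neg_geometric_of_limitSplit {β : HBeta} (S : B12Beta.OneLoopSplit β) {binf c₀ θ Cr γ : ℝ}
    (hconv : ∀ k, |S.β0 k - binf| ≤ c₀ * θ ^ k)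
    (hAF1 : ∀ k (p : Fin (k + 1) → ℝ), p ∈ B12Beta.HistBox γ k → |S.β1 k p| ≤ Cr * p (Fin.last k))
    (hCr : 0 ≤ Cr) (hγ : Cr * γ ≤ binf) (k : ℕ) (p : Fin (k + 1) → ℝ) (hp : p ∈ B12Beta.HistBox γ k) :
    -(c₀ * θ ^ k) ≤ β k p := by
  have h1 := abs_le.mp (hconv k)
  have h2 := abs_le.mp (hAF1 k p hp)
  have hlast : Cr * p (Fin.last k) ≤ Cr * γ := mul_le_mul_of_nonneg_left (hp (Fin.last k)).2 hCr
  rw [S.split k p]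
  linarith [h1.1, h2.1]

/-- **(A-ps) from the limit form.**  If the one-loop coefficients converge geometrically, `|β⁰_{k+1} − β⁰_∞| ≤ c₀θ^k`
(`0 ≤ θ < 1`), the remainder satisfies (AF-1) `|β¹_{k+1}(g_0,…,g_k)| ≤ C g_k` on ]0,γ]-histories and `Cγ ≤ β⁰_∞`, then
the partial sums of the β's along box histories are bounded below by `−c₀/(1−θ)` — the exact endpoint hypothesis of
§7 — with NO hypothesis on the signs of `β⁰_1, …, β⁰_{k₀}`. [folklore] -/
theorem betaPartialSumsLowerH_of_limitSplit {β : HBeta} (S : B12Beta.OneLoopSplit β) {binf c₀ θ Cr γ : ℝ}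
    (hθ0 : 0 ≤ θ) (hθ1 : θ < 1) (hc₀ : 0 ≤ c₀)
    (hconv : ∀ k, |S.β0 k - binf| ≤ c₀ * θ ^ k)
    (hAF1 : ∀ k (p : Fin (k + 1) → ℝ), p ∈ B12Beta.HistBox γ k → |S.β1 k p| ≤ Cr * p (Fin.last k))
    (hCr : 0 ≤ Cr) (hγ : Cr * γ ≤ binf) :
    BetaPartialSumsLowerH (c₀ / (1 - θ)) γ β := by
  intro g hg k n _
  have hstep : ∀ j, -(c₀ * θ ^ j) ≤ β j (prefixOf g j) := fun j =>
    beta_ge_neg_geometric_of_limitSplit S hconv hAF1 hCr hγ j _ (fun i => hg i)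
  have h1θ : 0 < 1 - θ := by linarith
  have hgeom : ∑ j ∈ Finset.Ico k n, θ ^ j ≤ θ ^ k / (1 - θ) := geom_sum_Ico_le_of_lt_one hθ0 hθ1
  have hθk : θ ^ k / (1 - θ) ≤ 1 / (1 - θ) :=
    div_le_div_of_nonneg_right (pow_le_one₀ hθ0 hθ1.le) h1θ.le
  have hsum : ∑ j ∈ Finset.Ico k n, c₀ * θ ^ j ≤ c₀ / (1 - θ) := by
    rw [← Finset.mul_sum]
    calc c₀ * ∑ j ∈ Finset.Ico k n, θ ^ j ≤ c₀ * (1 / (1 - θ)) :=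
          mul_le_mul_of_nonneg_left (hgeom.trans hθk) hc₀
      _ = c₀ / (1 - θ) := mul_one_div c₀ (1 - θ)
  calc -(c₀ / (1 - θ)) ≤ -∑ j ∈ Finset.Ico k n, c₀ * θ ^ j := neg_le_neg hsum
    _ = ∑ j ∈ Finset.Ico k n, -(c₀ * θ ^ j) := (Finset.sum_neg_distrib _).symm
    _ ≤ ∑ j ∈ Finset.Ico k n, β j (prefixOf g j) := Finset.sum_le_sum fun j _ => hstep j

/-- **Positivity on the tail.**  Under the same limit form, from any `k₀` with `c₀θ^{k₀} ≤ β⁰_∞/4` on, and for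
`Cγ ≤ β⁰_∞/4`: `β_{k+1}(g_0,…,g_k) ≥ β⁰_∞/2` on ]0,γ]-boxes (`0 ≤ θ ≤ 1`). [folklore] -/
theorem betaLower_tail_of_limitSplit {β : HBeta} (S : B12Beta.OneLoopSplit β) {binf c₀ θ Cr γ : ℝ} {k₀ : ℕ}
    (hθ0 : 0 ≤ θ) (hθ1 : θ ≤ 1) (hc₀ : 0 ≤ c₀)
    (hconv : ∀ k, |S.β0 k - binf| ≤ c₀ * θ ^ k)
    (hAF1 : ∀ k (p : Fin (k + 1) → ℝ), p ∈ B12Beta.HistBox γ k → |S.β1 k p| ≤ Cr * p (Fin.last k))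
    (hCr : 0 ≤ Cr) (hk₀ : c₀ * θ ^ k₀ ≤ binf / 4) (hγ : Cr * γ ≤ binf / 4) :
    ∀ k, k₀ ≤ k → ∀ v ∈ Box γ k, binf / 2 ≤ β k v := by
  intro k hk v hv
  have hp : v ∈ B12Beta.HistBox γ k := histBox_of_mem_box hv
  have h1 := abs_le.mp (hconv k)
  have h2 := abs_le.mp (hAF1 k v hp)
  have hlast : Cr * v (Fin.last k) ≤ Cr * γ := mul_le_mul_of_nonneg_left (hp (Fin.last k)).2 hCr
  have hθk : c₀ * θ ^ k ≤ c₀ * θ ^ k₀ := mul_le_mul_of_nonneg_left (pow_le_pow_of_le_one hθ0 hθ1 hk) hc₀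
  rw [S.split k v]
  linarith [h1.1, h2.1]

/-- A `k₀` as required exists: `c₀θ^k → 0`. [folklore] -/
theorem exists_k0_of_geometric {c₀ θ b : ℝ} (hθ1 : θ < 1) (hb : 0 < b) :
    ∃ k₀ : ℕ, c₀ * θ ^ k₀ ≤ b := by
  by_cases hc : c₀ ≤ 0
  · exact ⟨0, by simpa using hc.trans hb.le⟩
  · push Not at hc
    obtain ⟨n, hn⟩ := exists_pow_lt_of_lt_one (div_pos hb hc) hθ1
    refine ⟨n, ?_⟩
    have := (lt_div_iff₀ hc).mp hn
    linarith [mul_comm (θ ^ n) c₀]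

/-- **All-k positivity needs exactly the finite list of small-k signs.**  Limit form + `Cγ ≤ β⁰_∞/4` + the finitely
many checks `β⁰_{k+1} ≥ 3β⁰_∞/4` for `k < k₀` (row BETA-an5/num of the cell: (AF-0s)) give
`FlowStep.BetaLowerH (β⁰_∞/2) γ β`. [folklore] -/
theorem betaLowerH_of_limitSplit {β : HBeta} (S : B12Beta.OneLoopSplit β) {binf c₀ θ Cr γ : ℝ} {k₀ : ℕ}
    (hθ0 : 0 ≤ θ) (hθ1 : θ ≤ 1) (hc₀ : 0 ≤ c₀)
    (hconv : ∀ k, |S.β0 k - binf| ≤ c₀ * θ ^ k)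
    (hAF1 : ∀ k (p : Fin (k + 1) → ℝ), p ∈ B12Beta.HistBox γ k → |S.β1 k p| ≤ Cr * p (Fin.last k))
    (hCr : 0 ≤ Cr) (hk₀ : c₀ * θ ^ k₀ ≤ binf / 4) (hγ : Cr * γ ≤ binf / 4)
    (hsmall : ∀ k, k < k₀ → 3 * binf / 4 ≤ S.β0 k) :
    BetaLowerH (binf / 2) γ β := by
  intro k v hv
  by_cases hk : k₀ ≤ k
  · exact betaLower_tail_of_limitSplit S hθ0 hθ1 hc₀ hconv hAF1 hCr hk₀ hγ k hk v hv
  · push Not at hk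
    have hp : v ∈ B12Beta.HistBox γ k := histBox_of_mem_box hv
    have h2 := abs_le.mp (hAF1 k v hp)
    have hlast : Cr * v (Fin.last k) ≤ Cr * γ := mul_le_mul_of_nonneg_left (hp (Fin.last k)).2 hCr
    have h0 := hsmall k hk
    rw [S.split k v]
    linarith [h2.1]

/-- **Endpoint existence from the limit form** (forward-generated constructions): geometric convergence of the
one-loop coefficients, (AF-1) with `Cγ₀ ≤ β⁰_∞`, the printed upper bound and continuity suffice — NO small-k signs.
[cite: Balaban1987RG1, Thm 2 p.259 (first sentence) and (2.12)–(2.14) p.268] -/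
theorem endpointExistence_of_limitSplit {C : B12.Construction} {β : HBeta} (hgen : ForwardGenerated C β)
    (S : B12Beta.OneLoopSplit β) {γ₀ binf c₀ θ Cr β' : ℝ} (hγ₀ : 0 < γ₀) (hθ0 : 0 ≤ θ) (hθ1 : θ < 1)
    (hc₀ : 0 ≤ c₀) (hconv : ∀ k, |S.β0 k - binf| ≤ c₀ * θ ^ k)
    (hAF1 : ∀ k (p : Fin (k + 1) → ℝ), p ∈ B12Beta.HistBox γ₀ k → |S.β1 k p| ≤ Cr * p (Fin.last k))
    (hCr : 0 ≤ Cr) (hγ : Cr * γ₀ ≤ binf) (hβ' : 0 ≤ β') (hcont : BetaContH γ₀ β) (hup : BetaUpperH β' γ₀ β) :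
    EndpointExistence C :=
  endpointExistence_of_partialSums hgen hγ₀ (div_nonneg hc₀ (by linarith)) hβ' hcont
    (betaPartialSumsLowerH_of_limitSplit S hθ0 hθ1 hc₀ hconv hAF1 hCr hγ) hup

/-- **The p. 355 unconditional reading from the limit form**: `B16.Sect2Unconditional` and (0.1) with a bare
coupling for every renormalised `g ≤ g⋆`, from the cell's `World` bookkeeping (`Nodes`), the modelling clauses, the
limit form of the one-loop split with `Cγ₀ ≤ β⁰_∞`, the printed upper bound, continuity, and the smallness
`(c₀/(1−θ))γ² ≤ β₀(2+β₀)` of the volume constant — again with NO small-k signs.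
[cite: Balaban1989LargeFieldII, p.355; Balaban1987RG1, (2.12)–(2.14) p.268] -/
theorem p355Unconditional_of_limitSplit (w : World) (hγw : 0 < w.γ) {γ₀ : ℝ} (hγ₀ : w.γ ≤ γ₀)
    (hβup : 0 ≤ w.βup) (hnodes : ∀ P, Nodes (leaves w P)) {β : HBeta} (hgen : ForwardGenerated w.C.toB12 β)
    (hhalt : HaltsOutside w.C.toB12 β) (hcur : CurriesHBeta w.C.toB12 β) (hcont : BetaContH γ₀ β)
    (hup : BetaUpperH w.βup γ₀ β) (S : B12Beta.OneLoopSplit β) {binf c₀ θ Cr : ℝ} (hθ0 : 0 ≤ θ) (hθ1 : θ < 1)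
    (hc₀ : 0 ≤ c₀) (hconv : ∀ k, |S.β0 k - binf| ≤ c₀ * θ ^ k)
    (hAF1 : ∀ k (p : Fin (k + 1) → ℝ), p ∈ B12Beta.HistBox γ₀ k → |S.β1 k p| ≤ Cr * p (Fin.last k))
    (hCr : 0 ≤ Cr) (hγ : Cr * γ₀ ≤ binf) (hMγ : c₀ / (1 - θ) * w.γ ^ 2 ≤ w.β₀ * (2 + w.β₀)) :
    B16.Sect2Unconditional w.C ∧
      ∃ Em Ep : ℝ, ∀ m : ℕ, ∃ gstar : ℝ, 0 < gstar ∧ ∀ g : ℝ, 0 < g → g ≤ gstar →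
        ∀ K : ℕ, ∃ g0 : ℝ, (w.C ⟨K, m, g0⟩).flow.g K = g ∧
          ∀ k, k ≤ K → ∀ V : (w.C ⟨K, m, g0⟩).Cfg k, B16.UVIneq (w.C ⟨K, m, g0⟩) k V Em Ep :=
  p355Unconditional_of_partialSums w hγw hγ₀ (div_nonneg hc₀ (by linarith)) hβup hMγ hnodes hgen hhalt hcur hcont
    (betaPartialSumsLowerH_of_limitSplit S hθ0 hθ1 hc₀ hconv hAF1 hCr hγ) hup

/-- **Theorem 2 as printed from the limit form + the finite list of small-k signs** (forward-generated
constructions): (0.31) for all k is where (AF-0s) is genuinely consumed. [cite: Balaban1987RG1, Thm 2 p.259 with (0.31)] -/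
theorem thm2Printed_of_limitSplit {C : B12.Construction} {β : HBeta} (hgen : ForwardGenerated C β)
    (S : B12Beta.OneLoopSplit β) {L γ₀ binf c₀ θ Cr β' : ℝ} {k₀ : ℕ} (hL : 1 < L) (hγ₀ : 0 < γ₀)
    (hbinf : 0 < binf) (hθ0 : 0 ≤ θ) (hθ1 : θ ≤ 1) (hc₀ : 0 ≤ c₀)
    (hconv : ∀ k, |S.β0 k - binf| ≤ c₀ * θ ^ k)
    (hAF1 : ∀ k (p : Fin (k + 1) → ℝ), p ∈ B12Beta.HistBox γ₀ k → |S.β1 k p| ≤ Cr * p (Fin.last k))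
    (hCr : 0 ≤ Cr) (hk₀ : c₀ * θ ^ k₀ ≤ binf / 4) (hγ : Cr * γ₀ ≤ binf / 4)
    (hsmall : ∀ k, k < k₀ → 3 * binf / 4 ≤ S.β0 k)
    (hup : BetaUpperH β' γ₀ β) (hcont : BetaContH γ₀ β) :
    B12.Thm2Printed C L := by
  have hlo : BetaLowerH (binf / 2) γ₀ β := betaLowerH_of_limitSplit S hθ0 hθ1 hc₀ hconv hAF1 hCr hk₀ hγ hsmall
  have hmem : (fun _ : Fin (0 + 1) => γ₀) ∈ Box γ₀ 0 := mem_box.mpr fun _ => ⟨hγ₀, le_rfl⟩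
  have hbβ : binf / 2 ≤ β' := (hlo 0 _ hmem).trans (hup 0 _ hmem)
  exact thm2Printed_of_boxBoundsH hgen hL hγ₀ (by linarith) hbβ hcont hlo hup

/-! ## 11. The limit form on the [III] side: ALL of (2.6)–(2.9) AND (2.46) along in-interval runs — no small-k signs (v1.7)

[III]-side companion of §10 (cell node T11.F, strat-b14's `B14FlowStep` §J).  §10 turned the limit form of the one-loop
split into the endpoint hypothesis (A-ps) and into `β ≥ β⁰_∞/2` from `k₀` on; (A-ps) gives (2.6)–(2.9) of
[Balaban1988Convergent] along runs (§8, `B14FlowStep.flowControl_of_partialSum`) but NOT the coupling-sum step (2.46)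
p. 263, which needs a positive drift (`B14FlowStep.sumIneq246_needs_positive_b`).  `B14FlowStep.avgAF_of_limitLower` /
`flowControl_of_limitLower` show that the two run-wise outputs of §10 — `β_{j+1}(g_j) ≥ −c₀θ^j` for all j and
`≥ β⁰_∞/2` for `j ≥ k₀` — are exactly "averaged asymptotic freedom with the defect `B = (β⁰_∞/2)k₀ + c₀/(1−θ)`", i.e.
the lower half of (0.31) up to an additive constant, and that this gives (2.46) as well.  Here the composition is
carried out along the runs of a forward-generated construction: the limit form + (AF-1) + the printed upper bound +
explicit γ-smallness ⇒ (2.6) ∧ (2.7) ∧ (2.8) ∧ (2.9) ∧ (2.46) on every in-interval run, with NO hypothesis on the signs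
of `β⁰_1, …, β⁰_{k₀}`.  So the finite list (AF-0s) of `thm2Printed_of_limitSplit` is consumed by the LITERAL (0.31) for
all `k` and by no other located consumer of the flow (cell BETA-SPEC §5, MISSING-B14.md v3 §9, GAPS C-sb14-6).
Bookkeeping only; (AF-0∞), (AF-0r), (AF-1) remain located UNPRINTED inputs. -/

/-- Run-wise dictionary (as inside `endStatementB_of_nodes_partialSums`): along an in-interval run of a construction
whose run-wise β-functions curry `β`, the realised value `β_{j+1}(g_j)` is `β j (g_0,…,g_j)` and the history prefix lies
in the box. [folklore] -/
theorem realised_eq_hist {C : B12.Construction} {β : HBeta} (hcur : CurriesHBeta C β) (P : B12.RunParams)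
    {γ γ₀ : ℝ} (hγ₀ : γ ≤ γ₀) (hI : (C P).flow.InInterval γ P.K) {j : ℕ} (hj : j < P.K) :
    (C P).flow.β (j + 1) ((C P).flow.g j) = β j (prefixOf (C P).flow.g j) ∧ prefixOf (C P).flow.g j ∈ Box γ₀ j := by
  refine ⟨?_, ?_⟩
  · have h := hcur P j ((C P).flow.g j) hj
    rw [update_prefixOf_last] at h
    exact h
  · exact mem_box.mpr fun i => by
      have hi : (i : ℕ) ≤ P.K := by have := i.isLt; omega
      exact ⟨(hI i hi).1, (hI i hi).2.trans hγ₀⟩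

/-- **§11 main: (2.6)–(2.9) AND (2.46) along an in-interval run from the LIMIT FORM, no small-k signs.**  For a
forward-generated construction that halts outside, with curried family `β` split as `β = β⁰ + β¹` (`B12Beta.OneLoopSplit`)
satisfying: geometric convergence `|β⁰_{k+1} − β⁰_∞| ≤ c₀θ^k` (`0 ≤ θ < 1`, `c₀ ≥ 0`, `β⁰_∞ > 0`), (AF-1)
`|β¹_{k+1}(g_0,…,g_k)| ≤ C g_k` on `]0,γ₀]`-histories with `Cγ₀ ≤ β⁰_∞/4`, a `k₀` with `c₀θ^{k₀} ≤ β⁰_∞/4`, the PRINTED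
upper bound `β ≤ β′` on the boxes ([Balaban1987RG1] p. 264), strat-b14's `SmallnessFor γ β′ β₀ L p` (`γ ≤ γ₀`) and the
γ-smallness of the defect `B = (β⁰_∞/2)k₀ + c₀/(1−θ)` — `Bγ² ≤ β₀(2+β₀)`, `Bγ² ≤ 1/2`, `(√2)^{κ₀−6}(4γ⁴/β⁰_∞ + γ⁶) < 1`:
along every run staying in `]0,γ]` up to `K`, with sizes `R_j` as in (2.5), ALL of (2.6), (2.7), (2.8) (for
`ε_j = g_j A₀(log g_j⁻²)^p`), (2.9) with the printed constants and (2.46) for every `κ₀ ≥ 6` hold.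
Proof: (0.20) along the run (§2), §10's `beta_ge_neg_geometric_of_limitSplit` / `betaLower_tail_of_limitSplit` read
through the dictionary, then `B14FlowStep.flowControl_of_limitLower`. [cite: Balaban1988Convergent, (2.6)–(2.9) pp.255–256 and (2.46) p.263] -/
theorem flowControl_along_of_limitSplit {C : B12.Construction} {β : HBeta} (hgen : ForwardGenerated C β)
    (hhalt : HaltsOutside C β) (hcur : CurriesHBeta C β) (S : B12Beta.OneLoopSplit β)
    {γ γ₀ binf c₀ θ Cr β' β₀ : ℝ} {L p k₀ : ℕ} (Sm : B14FlowStep.SmallnessFor γ β' β₀ L p) {A₀ : ℝ}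
    (hA₀ : 0 ≤ A₀) (hγ₀ : γ ≤ γ₀) (hθ0 : 0 ≤ θ) (hθ1 : θ < 1) (hc₀ : 0 ≤ c₀) (hbinf : 0 < binf)
    (hconv : ∀ k, |S.β0 k - binf| ≤ c₀ * θ ^ k)
    (hAF1 : ∀ k (q : Fin (k + 1) → ℝ), q ∈ B12Beta.HistBox γ₀ k → |S.β1 k q| ≤ Cr * q (Fin.last k))
    (hCr : 0 ≤ Cr) (hk₀ : c₀ * θ ^ k₀ ≤ binf / 4) (hCγ : Cr * γ₀ ≤ binf / 4) (hup : BetaUpperH β' γ₀ β)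
    (hBγ : (binf / 2 * k₀ + c₀ / (1 - θ)) * γ ^ 2 ≤ β₀ * (2 + β₀))
    (hBγ' : (binf / 2 * k₀ + c₀ / (1 - θ)) * γ ^ 2 ≤ 1 / 2) {κ₀ : ℕ} (hκ : 6 ≤ κ₀)
    (hsmall : Real.sqrt 2 ^ (κ₀ - 6) * (2 * γ ^ 4 / (binf / 2) + γ ^ 6) < 1)
    (P : B12.RunParams) (hI : (C P).flow.InInterval γ P.K)
    (R : ℕ → ℕ) (hR : ∀ j, j ≤ P.K → B14.IsRj L p ((C P).flow.g j) (R j)) :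
    (B14.FlowIneq26 (C P).flow.g β' β₀ P.K ∧ B14.FlowIneq27 (C P).flow.g β' β₀ p P.K ∧
      B14.FlowIneq28 (epsK A₀ p (C P).flow) (C P).flow.g β' β₀ P.K ∧
      B14FlowStep.FlowIneq29 R (C P).flow.g L β' β₀ P.K) ∧ B14FlowStep.SumIneq246 (C P).flow.g κ₀ P.K := by
  have hrg : (C P).flow.SatisfiesRG P.K := satisfiesRG_of_inInterval hgen hhalt hcur P hI
  have hCγ1 : Cr * γ₀ ≤ binf := by linarith
  have hub : ∀ j, j < P.K → (C P).flow.β (j + 1) ((C P).flow.g j) ≤ β' := by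
    intro j hj
    obtain ⟨hpt, hbox⟩ := realised_eq_hist hcur P hγ₀ hI hj
    rw [hpt]; exact hup j _ hbox
  have hlo : ∀ j, j < P.K → -(c₀ * θ ^ j) ≤ (C P).flow.β (j + 1) ((C P).flow.g j) := by
    intro j hj
    obtain ⟨hpt, hbox⟩ := realised_eq_hist hcur P hγ₀ hI hj
    rw [hpt]
    exact beta_ge_neg_geometric_of_limitSplit S hconv hAF1 hCr hCγ1 j _ (histBox_of_mem_box hbox)
  have htail : ∀ j, k₀ ≤ j → j < P.K → binf / 2 ≤ (C P).flow.β (j + 1) ((C P).flow.g j) := by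
    intro j hk hj
    obtain ⟨hpt, hbox⟩ := realised_eq_hist hcur P hγ₀ hI hj
    rw [hpt]
    exact betaLower_tail_of_limitSplit S hθ0 hθ1.le hc₀ hconv hAF1 hCr hk₀ hCγ j hk _ hbox
  exact B14FlowStep.flowControl_of_limitLower (C P).flow P.K Sm hA₀ R hR hrg hI hub hθ0 hθ1 hc₀
    (half_pos hbinf) hlo htail hBγ hBγ' hκ hsmall

/-- **§11, sizes supplied**: the same with the sizes `R_j` of (2.5) PRODUCED (`B14FlowStep.isRj_exists`, `L ≥ 2` from
`SmallnessFor`) rather than given — so along every in-interval run there ARE sizes for which all of (2.6)–(2.9) and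
(2.46) hold. [cite: Balaban1988Convergent, (2.5)–(2.9) pp.255–256 and (2.46) p.263] -/
theorem flowControl_along_of_limitSplit' {C : B12.Construction} {β : HBeta} (hgen : ForwardGenerated C β)
    (hhalt : HaltsOutside C β) (hcur : CurriesHBeta C β) (S : B12Beta.OneLoopSplit β)
    {γ γ₀ binf c₀ θ Cr β' β₀ : ℝ} {L p k₀ : ℕ} (Sm : B14FlowStep.SmallnessFor γ β' β₀ L p) {A₀ : ℝ}
    (hA₀ : 0 ≤ A₀) (hγ₀ : γ ≤ γ₀) (hθ0 : 0 ≤ θ) (hθ1 : θ < 1) (hc₀ : 0 ≤ c₀) (hbinf : 0 < binf)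
    (hconv : ∀ k, |S.β0 k - binf| ≤ c₀ * θ ^ k)
    (hAF1 : ∀ k (q : Fin (k + 1) → ℝ), q ∈ B12Beta.HistBox γ₀ k → |S.β1 k q| ≤ Cr * q (Fin.last k))
    (hCr : 0 ≤ Cr) (hk₀ : c₀ * θ ^ k₀ ≤ binf / 4) (hCγ : Cr * γ₀ ≤ binf / 4) (hup : BetaUpperH β' γ₀ β)
    (hBγ : (binf / 2 * k₀ + c₀ / (1 - θ)) * γ ^ 2 ≤ β₀ * (2 + β₀))
    (hBγ' : (binf / 2 * k₀ + c₀ / (1 - θ)) * γ ^ 2 ≤ 1 / 2) {κ₀ : ℕ} (hκ : 6 ≤ κ₀)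
    (hsmall : Real.sqrt 2 ^ (κ₀ - 6) * (2 * γ ^ 4 / (binf / 2) + γ ^ 6) < 1)
    (P : B12.RunParams) (hI : (C P).flow.InInterval γ P.K) :
    ∃ R : ℕ → ℕ, (∀ j, B14.IsRj L p ((C P).flow.g j) (R j)) ∧
      (B14.FlowIneq26 (C P).flow.g β' β₀ P.K ∧ B14.FlowIneq27 (C P).flow.g β' β₀ p P.K ∧
        B14.FlowIneq28 (epsK A₀ p (C P).flow) (C P).flow.g β' β₀ P.K ∧
        B14FlowStep.FlowIneq29 R (C P).flow.g L β' β₀ P.K) ∧ B14FlowStep.SumIneq246 (C P).flow.g κ₀ P.K := by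
  choose R hR using fun j => B14FlowStep.isRj_exists Sm.hL p ((C P).flow.g j)
  exact ⟨R, hR, flowControl_along_of_limitSplit hgen hhalt hcur S Sm hA₀ hγ₀ hθ0 hθ1 hc₀ hbinf hconv hAF1 hCr hk₀
    hCγ hup hBγ hBγ' hκ hsmall P hI R fun j _ => hR j⟩

/-- **§11 + §10 together (the cell's END statement WITH (2.46), from the limit form).**  For a world `w` as in
`p355Unconditional_of_limitSplit` whose curried family carries the limit form of the one-loop split: the p. 355
unconditional reading (`B16.Sect2Unconditional` + (0.1) unconditional) AND, along every run of the world's construction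
that stays in `]0,γ]`, the coupling-sum inequality (2.46) of [Balaban1988Convergent] p. 263 for every `κ₀ ≥ 6` — all
with NO hypothesis on the signs of the finitely many small-k one-loop coefficients.  ((2.6)–(2.9) along such runs:
`flowControl_along_of_limitSplit'`.)  Nothing of the series is asserted. [cite: Balaban1989LargeFieldII, p.355; Balaban1988Convergent, (2.46) p.263] -/
theorem p355Unconditional_and_sum246_of_limitSplit (w : World) (hγw : 0 < w.γ) {γ₀ : ℝ} (hγ₀ : w.γ ≤ γ₀)
    (hβup : 0 ≤ w.βup) (hnodes : ∀ P, Nodes (leaves w P)) {β : HBeta} (hgen : ForwardGenerated w.C.toB12 β)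
    (hhalt : HaltsOutside w.C.toB12 β) (hcur : CurriesHBeta w.C.toB12 β) (hcont : BetaContH γ₀ β)
    (hup : BetaUpperH w.βup γ₀ β) (S : B12Beta.OneLoopSplit β) {binf c₀ θ Cr : ℝ} {k₀ : ℕ} (hθ0 : 0 ≤ θ)
    (hθ1 : θ < 1) (hc₀ : 0 ≤ c₀) (hbinf : 0 < binf) (hconv : ∀ k, |S.β0 k - binf| ≤ c₀ * θ ^ k)
    (hAF1 : ∀ k (q : Fin (k + 1) → ℝ), q ∈ B12Beta.HistBox γ₀ k → |S.β1 k q| ≤ Cr * q (Fin.last k))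
    (hCr : 0 ≤ Cr) (hk₀ : c₀ * θ ^ k₀ ≤ binf / 4) (hCγ : Cr * γ₀ ≤ binf / 4)
    (hMγ : c₀ / (1 - θ) * w.γ ^ 2 ≤ w.β₀ * (2 + w.β₀))
    (hBγ' : (binf / 2 * k₀ + c₀ / (1 - θ)) * w.γ ^ 2 ≤ 1 / 2) {κ₀ : ℕ} (hκ : 6 ≤ κ₀)
    (hsmall : Real.sqrt 2 ^ (κ₀ - 6) * (2 * w.γ ^ 4 / (binf / 2) + w.γ ^ 6) < 1) :
    (B16.Sect2Unconditional w.C ∧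
      ∃ Em Ep : ℝ, ∀ m : ℕ, ∃ gstar : ℝ, 0 < gstar ∧ ∀ g : ℝ, 0 < g → g ≤ gstar →
        ∀ K : ℕ, ∃ g0 : ℝ, (w.C ⟨K, m, g0⟩).flow.g K = g ∧
          ∀ k, k ≤ K → ∀ V : (w.C ⟨K, m, g0⟩).Cfg k, B16.UVIneq (w.C ⟨K, m, g0⟩) k V Em Ep) ∧
    ∀ P : B12.RunParams, (w.C.toB12 P).flow.InInterval w.γ P.K →
      B14FlowStep.SumIneq246 (w.C.toB12 P).flow.g κ₀ P.K := by
  have hCγ1 : Cr * γ₀ ≤ binf := by linarith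
  refine ⟨p355Unconditional_of_limitSplit w hγw hγ₀ hβup hnodes hgen hhalt hcur hcont hup S hθ0 hθ1 hc₀ hconv
    hAF1 hCr hCγ1 hMγ, fun P hI => ?_⟩
  have hrg : (w.C.toB12 P).flow.SatisfiesRG P.K := satisfiesRG_of_inInterval hgen hhalt hcur P hI
  have hlo : ∀ j, j < P.K → -(c₀ * θ ^ j) ≤ (w.C.toB12 P).flow.β (j + 1) ((w.C.toB12 P).flow.g j) := by
    intro j hj
    obtain ⟨hpt, hbox⟩ := realised_eq_hist hcur P hγ₀ hI hj
    rw [hpt]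
    exact beta_ge_neg_geometric_of_limitSplit S hconv hAF1 hCr hCγ1 j _ (histBox_of_mem_box hbox)
  have htail : ∀ j, k₀ ≤ j → j < P.K → binf / 2 ≤ (w.C.toB12 P).flow.β (j + 1) ((w.C.toB12 P).flow.g j) := by
    intro j hk hj
    obtain ⟨hpt, hbox⟩ := realised_eq_hist hcur P hγ₀ hI hj
    rw [hpt]
    exact betaLower_tail_of_limitSplit S hθ0 hθ1.le hc₀ hconv hAF1 hCr hk₀ hCγ j hk _ hbox
  exact B14FlowStep.sumIneq246_of_avgAF (w.C.toB12 P).flow P.K (half_pos hbinf) hrg hI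
    (B14FlowStep.avgAF_of_limitLower (w.C.toB12 P).flow P.K hθ0 hθ1 hc₀ (half_pos hbinf).le hlo htail) hBγ' hκ hsmall

/-! ### The MINIMAL form on both sides: an EVENTUAL positive lower bound on the boxes + the printed two-sided bound
(no split, no rate, no limit)

What the located consumers of the flow really need from the β-functions — both the endpoint half ([I] side, (A-ps))
and the [III]-side inequalities incl. (2.46) — is implied by:
  (EV-AF) `∃ b > 0, k₀ : β_{k+1}(g_0,…,g_k) ≥ b` on `]0,γ₀]^{k+1}` for all `k ≥ k₀`;
  (TS)    the printed two-sided bound `−β′ ≤ β_{k+1} ≤ β′` on the boxes ([Balaban1987RG1] p. 264 "uniformly bounded");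
  (C)     joint continuity on the boxes (for the shooting).
The one-loop split / limit form of §10 and of BETA-SPEC §4 is a ROUTE to (EV-AF) (e.g. `β⁰_{k+1} → β⁰_∞ > 0` — plain
convergence, no rate — together with `sup_{]0,γ₀]} |β¹_{k+1}| ≤ β⁰_∞/4` for `k ≥ k₀`); a RATE (AF-0r) is not needed by
any located consumer: the finitely many early scales are paid for by the printed `−β′` (defect `β′k₀`, resp.
`(b+β′)k₀`), i.e. by γ-smallness.  (EV-AF), like every `β ≥ b`-type statement, is a located UNPRINTED input. -/

/-- **(A-ps) from an EVENTUAL lower bound + the printed lower half of the two-sided bound.**  If `β_{k+1} ≥ b ≥ 0` on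
`]0,γ₀]^{k+1}` for `k ≥ k₀` and `β_{k+1} ≥ −β′` on all boxes (`β′ ≥ 0`), then the partial sums along box histories are
`≥ −β′k₀`: `BetaPartialSumsLowerH (β′k₀) γ₀ β`.  No split, no rate. [folklore] -/
theorem betaPartialSumsLowerH_of_eventualLower {β : HBeta} {γ₀ b β' : ℝ} {k₀ : ℕ} (hb : 0 ≤ b) (hβ' : 0 ≤ β')
    (htail : ∀ k, k₀ ≤ k → ∀ v ∈ Box γ₀ k, b ≤ β k v) (hlo : ∀ k, ∀ v ∈ Box γ₀ k, -β' ≤ β k v) :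
    BetaPartialSumsLowerH (β' * k₀) γ₀ β := by
  intro g hg m n hmn
  have hbox : ∀ j, prefixOf g j ∈ Box γ₀ j := fun j => mem_box.mpr fun i => hg i
  have hpt : ∀ j ∈ Finset.Ico m n, -(if j < k₀ then β' else 0) ≤ β j (prefixOf g j) := by
    intro j _
    by_cases hjk : j < k₀
    · rw [if_pos hjk]; exact hlo j _ (hbox j)
    · rw [if_neg hjk, neg_zero]; exact hb.trans (htail j (not_lt.mp hjk) _ (hbox j))
  have hsum := Finset.sum_le_sum hpt
  have hs2 : ∑ j ∈ Finset.Ico m n, (if j < k₀ then β' else 0)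
      = (((Finset.Ico m n).filter (· < k₀)).card : ℝ) * β' := by
    rw [Finset.sum_ite, Finset.sum_const_zero, add_zero, Finset.sum_const, nsmul_eq_mul]
  rw [Finset.sum_neg_distrib, hs2] at hsum
  have hcard : (((Finset.Ico m n).filter (· < k₀)).card : ℝ) ≤ k₀ := by
    exact_mod_cast B14FlowStep.card_filter_lt_Ico_le m n k₀
  have h1 : (((Finset.Ico m n).filter (· < k₀)).card : ℝ) * β' ≤ (k₀ : ℝ) * β' :=
    mul_le_mul_of_nonneg_right hcard hβ'
  linarith

/-- **(EV-AF) from the one-loop split with ONE-SIDED, ZEROTH-ORDER tail control of the remainder** — the weakest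
form of "(AF-0) + (AF-1)" that the located consumers use: `β⁰_{k+1} ≥ 2b` for `k ≥ k₀` (e.g. from `β⁰_{k+1} → β⁰_∞ > 0`,
plain convergence, no rate) and the LOWER bound `β¹_{k+1} ≥ −b` on `]0,γ₀]^{k+1}` for `k ≥ k₀` (a k-uniform modulus of
continuity of the remainder at zero coupling on the tail suffices; no Lipschitz constant, no derivative) give
`β_{k+1} ≥ b` on the boxes for `k ≥ k₀`.  Compare (AF-1) `|β¹_{k+1}| ≤ C g_k` (BETA-SPEC §0.3; cell row an4, located
failure G-pv20-3): only its one-sided consequence on small boxes is consumed. [folklore] -/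
theorem betaLowerTail_of_split_oneSided {β : HBeta} (S : B12Beta.OneLoopSplit β) {γ₀ b : ℝ} {k₀ : ℕ}
    (hAF0 : ∀ k, k₀ ≤ k → 2 * b ≤ S.β0 k)
    (hAF1w : ∀ k, k₀ ≤ k → ∀ v ∈ Box γ₀ k, -b ≤ S.β1 k v) :
    ∀ k, k₀ ≤ k → ∀ v ∈ Box γ₀ k, b ≤ β k v := by
  intro k hk v hv
  rw [S.split k v]
  linarith [hAF0 k hk, hAF1w k hk v hv]

/-- **Even the LITERAL lower half of (0.31) needs the small-k signs only on COARSE lattices.**  Along a run solving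
(0.20) up to `K` with `β_{j+1}(g_j) ≥ −β′` for all `j < K` and `≥ b ≥ 0` for `k₀ ≤ j < K`: as soon as the number of
steps satisfies `(3b + 2β′)k₀ ≤ bK` (i.e. `ε = L^{−K}` below a fixed `ε₀`), the endpoint running
`1/g_K² + (b/2)(K − k) ≤ 1/g_k²` holds for EVERY `k ≤ K` — with `b/2` in place of `b` and no hypothesis on the signs at
the scales `j < k₀`.  (The upper half `1/g_k² ≤ 1/g_K² + β′(K−k)` is the printed bound, `B14.inv_sq_le_of_rg_upper`.)
So the finite list (AF-0s) of `thm2Printed_of_limitSplit` bears on (0.31) only for the finitely many lattice spacings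
`K < k₀(3 + 2β′/b)`. [cite: Balaban1987RG1, (0.31) p.259 and (0.20) p.256] -/
theorem discrete031_lower_of_eventualLower_largeK (F : Flow) (K : ℕ) {b β' : ℝ} {k₀ : ℕ} (hb : 0 ≤ b)
    (hβ' : 0 ≤ β') (hrg : F.SatisfiesRG K) (hlo : ∀ j, j < K → -β' ≤ F.β (j + 1) (F.g j))
    (htail : ∀ j, k₀ ≤ j → j < K → b ≤ F.β (j + 1) (F.g j)) (hK : (3 * b + 2 * β') * k₀ ≤ b * K) :
    ∀ k, k ≤ K → 1 / (F.g K) ^ 2 + b / 2 * ((K : ℝ) - k) ≤ 1 / (F.g k) ^ 2 := by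
  intro k hk
  have hav := B14FlowStep.avgAF_of_eventualLower F K hβ' hb hlo htail
  have tel := Step.inv_sq_telescope ((Step.rgEq_iff F K).mp hrg) hk le_rfl
  by_cases hkk : k₀ ≤ k
  · -- all terms in the window are ≥ b
    have hsum : b * ((K : ℝ) - k) ≤ ∑ j ∈ Finset.Ico k K, F.β (j + 1) (F.g j) := by
      have h1 : ∑ _j ∈ Finset.Ico k K, b ≤ ∑ j ∈ Finset.Ico k K, F.β (j + 1) (F.g j) :=
        Finset.sum_le_sum fun j hj =>
          htail j (hkk.trans (Finset.mem_Ico.mp hj).1) (Finset.mem_Ico.mp hj).2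
      have h2 : ∑ _j ∈ Finset.Ico k K, b = b * ((K : ℝ) - k) := by
        rw [Finset.sum_const, Nat.card_Ico, nsmul_eq_mul, Nat.cast_sub hk]; ring
      linarith
    have hKk : (0 : ℝ) ≤ (K : ℝ) - k := by
      have : (k : ℝ) ≤ K := by exact_mod_cast hk
      linarith
    have := mul_nonneg hb hKk
    linarith
  · -- k < k₀: use the averaged bound and the largeness of K
    push Not at hkk
    have h1 := hav k K hk le_rfl
    have hkk' : (k : ℝ) ≤ k₀ := by exact_mod_cast hkk.le
    have hprod : 0 ≤ b * ((k₀ : ℝ) - k) := mul_nonneg hb (sub_nonneg.mpr hkk')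
    have step : (b + β') * (k₀ : ℝ) ≤ b / 2 * ((K : ℝ) - k) := by
      have e1 : b / 2 * ((K : ℝ) - k) - (b + β') * k₀
          = (b * K - (3 * b + 2 * β') * k₀) / 2 + b * ((k₀ : ℝ) - k) / 2 := by ring
      have e2 : 0 ≤ (b * K - (3 * b + 2 * β') * k₀) / 2 + b * ((k₀ : ℝ) - k) / 2 := by
        have : 0 ≤ b * (K : ℝ) - (3 * b + 2 * β') * k₀ := by linarith
        linarith
      linarith
    linarith

/-- History-typed form of the preceding lemma, along ONE solution of the history recursion (0.20) whose prefixes lie in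
the box: (EV-AF) from `k₀` on + the printed lower half `−β′` + `(3b + 2β′)k₀ ≤ bK` give the lower half of (0.31) with
`b/2` at every `k ≤ K`. [cite: Balaban1987RG1, (0.31) p.259 and (0.20) p.256] -/
theorem discrete031H_lower_of_eventualLower_largeK {β : HBeta} {K : ℕ} {gs : ℕ → ℝ} {γ₀ b β' : ℝ} {k₀ : ℕ}
    (hb : 0 ≤ b) (hβ' : 0 ≤ β') (hrg : RGEqH K β gs) (hbox : ∀ j, j < K → prefixOf gs j ∈ Box γ₀ j)
    (htail : ∀ k, k₀ ≤ k → ∀ v ∈ Box γ₀ k, b ≤ β k v) (hlo : ∀ k, ∀ v ∈ Box γ₀ k, -β' ≤ β k v)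
    (hK : (3 * b + 2 * β') * k₀ ≤ b * K) :
    ∀ k, k ≤ K → 1 / (gs K) ^ 2 + b / 2 * ((K : ℝ) - k) ≤ 1 / (gs k) ^ 2 := by
  intro k hk
  have tel := inv_sq_telescopeH hrg hk le_rfl
  -- pointwise: β_j ≥ b − (b+β′)·[j < k₀]
  have hpt : ∀ j ∈ Finset.Ico k K,
      b - (if j < k₀ then (b + β') else 0) ≤ β j (prefixOf gs j) := by
    intro j hj
    have hjK : j < K := (Finset.mem_Ico.mp hj).2
    by_cases hjk : j < k₀
    · rw [if_pos hjk]; have := hlo j _ (hbox j hjK); linarith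
    · rw [if_neg hjk]; have := htail j (not_lt.mp hjk) _ (hbox j hjK); linarith
  have hsum := Finset.sum_le_sum hpt
  have hs1 : ∑ _j ∈ Finset.Ico k K, (b : ℝ) = b * ((K : ℝ) - k) := by
    rw [Finset.sum_const, Nat.card_Ico, nsmul_eq_mul, Nat.cast_sub hk]; ring
  have hs2 : ∑ j ∈ Finset.Ico k K, (if j < k₀ then (b + β') else 0)
      = (((Finset.Ico k K).filter (· < k₀)).card : ℝ) * (b + β') := by
    rw [Finset.sum_ite, Finset.sum_const_zero, add_zero, Finset.sum_const, nsmul_eq_mul]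
  rw [Finset.sum_sub_distrib, hs1, hs2] at hsum
  by_cases hkk : k₀ ≤ k
  · -- no early scale in the window
    have hcard0 : ((Finset.Ico k K).filter (· < k₀)).card = 0 := by
      rw [Finset.card_eq_zero, Finset.filter_eq_empty_iff]
      intro j hj
      have := (Finset.mem_Ico.mp hj).1
      omega
    rw [hcard0] at hsum
    simp only [Nat.cast_zero, zero_mul, sub_zero] at hsum
    have hKk : (0 : ℝ) ≤ (K : ℝ) - k := by
      have : (k : ℝ) ≤ K := by exact_mod_cast hk
      linarith
    have := mul_nonneg hb hKk
    linarith
  · push Not at hkk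
    have hcard : (((Finset.Ico k K).filter (· < k₀)).card : ℝ) ≤ k₀ := by
      exact_mod_cast B14FlowStep.card_filter_lt_Ico_le k K k₀
    have hbb : 0 ≤ b + β' := by linarith
    have h1 : (((Finset.Ico k K).filter (· < k₀)).card : ℝ) * (b + β') ≤ (k₀ : ℝ) * (b + β') :=
      mul_le_mul_of_nonneg_right hcard hbb
    have hkk' : (k : ℝ) ≤ k₀ := by exact_mod_cast hkk.le
    have hprod : 0 ≤ b * ((k₀ : ℝ) - k) := mul_nonneg hb (sub_nonneg.mpr hkk')
    have step : (b + β') * (k₀ : ℝ) ≤ b / 2 * ((K : ℝ) - k) := by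
      have e1 : b / 2 * ((K : ℝ) - k) - (b + β') * k₀
          = (b * K - (3 * b + 2 * β') * k₀) / 2 + b * ((k₀ : ℝ) - k) / 2 := by ring
      have : 0 ≤ b * (K : ℝ) - (3 * b + 2 * β') * k₀ := by linarith
      linarith
    linarith

/-- **[Balaban1987RG1] Theorem 2's FULL CONCLUSION — run in `]0,γ]`, `g_K = g`, and the two-sided (0.31) — on every
lattice FINE ENOUGH, from (EV-AF) + (TS) + (C) alone** (forward-generated constructions; no split, no rate, no small-k
signs): for every torus exponent `m`, every `γ ∈ ]0,γ₀]`, every renormalised `g` with `1/g² ≥ 1/γ² + β′k₀`, and every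
number of steps `K` with `(3b + 2β′)k₀ ≤ bK` (i.e. `ε = L^{−K} ≤ ε₀`), some bare coupling produces a run with
`0 < g_k ≤ γ`, `g_K = g` and `1/g² + (b/2)(K−k) ≤ 1/g_k² ≤ 1/g² + β′(K−k)` for all `k ≤ K` — the discrete form of (0.31)
(`Step.Discrete031 (b/2) β′`; per-step constants `·/log L` give the printed logarithmic form, cf. `coeff_logL`).  What the
printed Theorem 2 says IN ADDITION is only the same for the finitely many coarse lattices `K < k₀(3 + 2β′/b)`, and that is
exactly where the finite list of small-k signs enters (`thm2Printed_of_limitSplit`).  A REDUCTION to located unprinted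
inputs; nothing of the series is asserted. [cite: Balaban1987RG1, Thm 2 (0.31) p.259] -/
theorem thm2_fineLattices_of_eventualLower {C : B12.Construction} {β : HBeta} (hgen : ForwardGenerated C β)
    {γ₀ b β' : ℝ} {k₀ : ℕ} (hb : 0 < b) (hβ' : 0 ≤ β') (hcont : BetaContH γ₀ β)
    (htail : ∀ k, k₀ ≤ k → ∀ v ∈ Box γ₀ k, b ≤ β k v) (hlo : ∀ k, ∀ v ∈ Box γ₀ k, -β' ≤ β k v)
    (hup : BetaUpperH β' γ₀ β) :
    ∀ (m : ℕ) (γ : ℝ), 0 < γ → γ ≤ γ₀ → ∀ g : ℝ, 0 < g → 1 / γ ^ 2 + β' * k₀ ≤ 1 / g ^ 2 →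
      ∀ K : ℕ, (3 * b + 2 * β') * k₀ ≤ b * K →
        ∃ g0 : ℝ, (C ⟨K, m, g0⟩).flow.InInterval γ K ∧ (C ⟨K, m, g0⟩).flow.g K = g ∧
          Step.Discrete031 (b / 2) β' K g (C ⟨K, m, g0⟩).flow.g := by
  intro m γ hγ hγle g hg hgM K hK
  have hps : BetaPartialSumsLowerH (β' * k₀) γ₀ β := betaPartialSumsLowerH_of_eventualLower hb.le hβ' htail hlo
  have hcont' : BetaContH γ β := fun k => (hcont k).mono (box_mono hγle k)
  have hup' : BetaUpperH β' γ β := fun k v hv => hup k v (box_mono hγle k hv)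
  obtain ⟨gs, hgsK, hrg, hI, hbounds⟩ := couplingTrajectory_exists_partialSums β hγ (by positivity) hβ' hcont'
    (betaPartialSumsLowerH_mono hγle hps) hup' K g hg hgM
  have heq : ∀ k, k ≤ K → (C ⟨K, m, gs 0⟩).flow.g k = gs k :=
    flow_eq_of_rgEqH (C ⟨K, m, gs 0⟩).flow β K (fun k hk => hgen.2 ⟨K, m, gs 0⟩ k hk)
      (hgen.1 ⟨K, m, gs 0⟩) hrg (fun k hk => (hI k hk).1)
  have hbox : ∀ j, j < K → prefixOf gs j ∈ Box γ₀ j := fun j hj =>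
    mem_box.mpr fun i => by
      have hi : (i : ℕ) ≤ K := by have := i.isLt; omega
      exact ⟨(hI i hi).1, (hI i hi).2.trans hγle⟩
  have hlow := discrete031H_lower_of_eventualLower_largeK hb.le hβ' hrg hbox htail hlo hK
  refine ⟨gs 0, fun k hk => ?_, ?_, fun k hk => ?_⟩
  · rw [heq k hk]; exact hI k hk
  · rw [heq K le_rfl]; exact hgsK
  · rw [heq k hk]
    refine ⟨?_, (hbounds k hk).2⟩
    have h := hlow k hk
    rw [hgsK] at h
    exact h

/-- **Endpoint existence from (EV-AF) + (TS) + (C)** (forward-generated constructions): a bare coupling for every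
renormalised `g ≤ g⋆ = (1/γ² + β′k₀)^{−1/2}`, uniformly in `K` — no split, no rate, no small-k signs. [cite: Balaban1987RG1, Thm 2 p.259 (first sentence)] -/
theorem endpointExistence_of_eventualLower {C : B12.Construction} {β : HBeta} (hgen : ForwardGenerated C β)
    {γ₀ b β' : ℝ} {k₀ : ℕ} (hγ₀ : 0 < γ₀) (hb : 0 ≤ b) (hβ' : 0 ≤ β') (hcont : BetaContH γ₀ β)
    (htail : ∀ k, k₀ ≤ k → ∀ v ∈ Box γ₀ k, b ≤ β k v) (hlo : ∀ k, ∀ v ∈ Box γ₀ k, -β' ≤ β k v)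
    (hup : BetaUpperH β' γ₀ β) : EndpointExistence C :=
  endpointExistence_of_partialSums hgen hγ₀ (by positivity) hβ' hcont
    (betaPartialSumsLowerH_of_eventualLower hb hβ' htail hlo) hup

/-- **The MINIMAL form, both sides at once.**  For a world `w` as in `p355Unconditional_of_partialSums` whose curried
family satisfies (EV-AF) with `b > 0` from `k₀` on, the printed two-sided bound `|β| ≤ β⁺` on the boxes and joint
continuity, with the γ-smallness `β⁺k₀γ² ≤ β₀(2+β₀)`, `(b+β⁺)k₀γ² ≤ 1/2`, `(√2)^{κ₀−6}(2γ⁴/b + γ⁶) < 1`: the p. 355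
unconditional reading (`B16.Sect2Unconditional` + (0.1) unconditional) AND (2.46) along every in-interval run — no
split, no rate, no small-k signs.  ((2.6)–(2.9) along such runs: `B14FlowStep.flowControl_of_eventualLower`.)
[cite: Balaban1989LargeFieldII, p.355; Balaban1988Convergent, (2.46) p.263] -/
theorem p355Unconditional_and_sum246_of_eventualLower (w : World) (hγw : 0 < w.γ) {γ₀ : ℝ} (hγ₀ : w.γ ≤ γ₀)
    (hβup : 0 ≤ w.βup) (hnodes : ∀ P, Nodes (leaves w P)) {β : HBeta} (hgen : ForwardGenerated w.C.toB12 β)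
    (hhalt : HaltsOutside w.C.toB12 β) (hcur : CurriesHBeta w.C.toB12 β) (hcont : BetaContH γ₀ β)
    (hup : BetaUpperH w.βup γ₀ β) (hlo : ∀ k, ∀ v ∈ Box γ₀ k, -w.βup ≤ β k v) {b : ℝ} {k₀ : ℕ} (hb : 0 < b)
    (htail : ∀ k, k₀ ≤ k → ∀ v ∈ Box γ₀ k, b ≤ β k v)
    (hMγ : w.βup * k₀ * w.γ ^ 2 ≤ w.β₀ * (2 + w.β₀)) (hBγ' : (b + w.βup) * k₀ * w.γ ^ 2 ≤ 1 / 2)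
    {κ₀ : ℕ} (hκ : 6 ≤ κ₀) (hsmall : Real.sqrt 2 ^ (κ₀ - 6) * (2 * w.γ ^ 4 / b + w.γ ^ 6) < 1) :
    (B16.Sect2Unconditional w.C ∧
      ∃ Em Ep : ℝ, ∀ m : ℕ, ∃ gstar : ℝ, 0 < gstar ∧ ∀ g : ℝ, 0 < g → g ≤ gstar →
        ∀ K : ℕ, ∃ g0 : ℝ, (w.C ⟨K, m, g0⟩).flow.g K = g ∧
          ∀ k, k ≤ K → ∀ V : (w.C ⟨K, m, g0⟩).Cfg k, B16.UVIneq (w.C ⟨K, m, g0⟩) k V Em Ep) ∧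
    ∀ P : B12.RunParams, (w.C.toB12 P).flow.InInterval w.γ P.K →
      B14FlowStep.SumIneq246 (w.C.toB12 P).flow.g κ₀ P.K := by
  have hps : BetaPartialSumsLowerH (w.βup * k₀) γ₀ β := betaPartialSumsLowerH_of_eventualLower hb.le hβup htail hlo
  refine ⟨p355Unconditional_of_partialSums w hγw hγ₀ (by positivity) hβup hMγ hnodes hgen hhalt hcur hcont hps hup,
    fun P hI => ?_⟩
  have hrg : (w.C.toB12 P).flow.SatisfiesRG P.K := satisfiesRG_of_inInterval hgen hhalt hcur P hI
  have hlo' : ∀ j, j < P.K → -w.βup ≤ (w.C.toB12 P).flow.β (j + 1) ((w.C.toB12 P).flow.g j) := by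
    intro j hj
    obtain ⟨hpt, hbox⟩ := realised_eq_hist hcur P hγ₀ hI hj
    rw [hpt]; exact hlo j _ hbox
  have htail' : ∀ j, k₀ ≤ j → j < P.K → b ≤ (w.C.toB12 P).flow.β (j + 1) ((w.C.toB12 P).flow.g j) := by
    intro j hk hj
    obtain ⟨hpt, hbox⟩ := realised_eq_hist hcur P hγ₀ hI hj
    rw [hpt]; exact htail j hk _ hbox
  exact B14FlowStep.sumIneq246_of_avgAF (w.C.toB12 P).flow P.K hb hrg hI
    (B14FlowStep.avgAF_of_eventualLower (w.C.toB12 P).flow P.K hβup hb.le hlo' htail') hBγ' hκ hsmall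

/-- **(v1.8) (2.6)–(2.9) AND (2.46) along in-interval runs from the MINIMAL form (EV-AF) + (TS)** — the history-typed
companion of `B14FlowStep.flowControl_of_eventualLower` (which takes the run-level hypotheses), composing the run-wise
dictionary `realised_eq_hist` exactly as `flowControl_along_of_limitSplit` does for the limit form: for a
forward-generated construction that halts outside, with curried family `β` satisfying `β_{k+1} ≥ b > 0` on
`]0,γ₀]^{k+1}` for `k ≥ k₀`, the PRINTED two-sided bound `−β′ ≤ β_{k+1} ≤ β′` on the boxes ([Balaban1987RG1] p. 264),
strat-b14's `SmallnessFor γ β′ β₀ L p` (`γ ≤ γ₀`) and the γ-smallness of the defect `(b+β′)k₀` —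
`(b+β′)k₀γ² ≤ β₀(2+β₀)`, `(b+β′)k₀γ² ≤ 1/2`, `(√2)^{κ₀−6}(2γ⁴/b + γ⁶) < 1`: along every run staying in `]0,γ]` up to
`K`, with sizes `R_j` as in (2.5), ALL of (2.6), (2.7), (2.8), (2.9) with the printed constants and (2.46) for every
`κ₀ ≥ 6`.  No split, no rate, no small-k signs; (EV-AF) is a located UNPRINTED input. [cite: Balaban1988Convergent, (2.6)–(2.9) pp.255–256 and (2.46) p.263] -/
theorem flowControl_along_of_eventualLower {C : B12.Construction} {β : HBeta} (hgen : ForwardGenerated C β)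
    (hhalt : HaltsOutside C β) (hcur : CurriesHBeta C β)
    {γ γ₀ b β' β₀ : ℝ} {L p k₀ : ℕ} (Sm : B14FlowStep.SmallnessFor γ β' β₀ L p) {A₀ : ℝ} (hA₀ : 0 ≤ A₀)
    (hγ₀ : γ ≤ γ₀) (hb : 0 < b) (htail : ∀ k, k₀ ≤ k → ∀ v ∈ Box γ₀ k, b ≤ β k v)
    (hlo : ∀ k, ∀ v ∈ Box γ₀ k, -β' ≤ β k v) (hup : BetaUpperH β' γ₀ β)
    (hBγ : (b + β') * k₀ * γ ^ 2 ≤ β₀ * (2 + β₀)) (hBγ' : (b + β') * k₀ * γ ^ 2 ≤ 1 / 2) {κ₀ : ℕ} (hκ : 6 ≤ κ₀)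
    (hsmall : Real.sqrt 2 ^ (κ₀ - 6) * (2 * γ ^ 4 / b + γ ^ 6) < 1)
    (P : B12.RunParams) (hI : (C P).flow.InInterval γ P.K)
    (R : ℕ → ℕ) (hR : ∀ j, j ≤ P.K → B14.IsRj L p ((C P).flow.g j) (R j)) :
    (B14.FlowIneq26 (C P).flow.g β' β₀ P.K ∧ B14.FlowIneq27 (C P).flow.g β' β₀ p P.K ∧
      B14.FlowIneq28 (epsK A₀ p (C P).flow) (C P).flow.g β' β₀ P.K ∧
      B14FlowStep.FlowIneq29 R (C P).flow.g L β' β₀ P.K) ∧ B14FlowStep.SumIneq246 (C P).flow.g κ₀ P.K := by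
  have hrg : (C P).flow.SatisfiesRG P.K := satisfiesRG_of_inInterval hgen hhalt hcur P hI
  have hub : ∀ j, j < P.K → (C P).flow.β (j + 1) ((C P).flow.g j) ≤ β' := by
    intro j hj
    obtain ⟨hpt, hbox⟩ := realised_eq_hist hcur P hγ₀ hI hj
    rw [hpt]; exact hup j _ hbox
  have hlo' : ∀ j, j < P.K → -β' ≤ (C P).flow.β (j + 1) ((C P).flow.g j) := by
    intro j hj
    obtain ⟨hpt, hbox⟩ := realised_eq_hist hcur P hγ₀ hI hj
    rw [hpt]; exact hlo j _ hbox
  have htail' : ∀ j, k₀ ≤ j → j < P.K → b ≤ (C P).flow.β (j + 1) ((C P).flow.g j) := by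
    intro j hk hj
    obtain ⟨hpt, hbox⟩ := realised_eq_hist hcur P hγ₀ hI hj
    rw [hpt]; exact htail j hk _ hbox
  exact B14FlowStep.flowControl_of_eventualLower (C P).flow P.K Sm hA₀ R hR hrg hI hub hlo' hb htail' hBγ hBγ' hκ
    hsmall

/-- **(v1.8) sizes supplied** (as `flowControl_along_of_limitSplit'`): along every in-interval run there ARE sizes
`R_j` obeying (2.5) (`B14FlowStep.isRj_exists`, `L ≥ 2` from `SmallnessFor`) for which all of (2.6)–(2.9) and (2.46)
hold, from (EV-AF) + (TS) + smallness. [cite: Balaban1988Convergent, (2.5)–(2.9) pp.255–256 and (2.46) p.263] -/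
theorem flowControl_along_of_eventualLower' {C : B12.Construction} {β : HBeta} (hgen : ForwardGenerated C β)
    (hhalt : HaltsOutside C β) (hcur : CurriesHBeta C β)
    {γ γ₀ b β' β₀ : ℝ} {L p k₀ : ℕ} (Sm : B14FlowStep.SmallnessFor γ β' β₀ L p) {A₀ : ℝ} (hA₀ : 0 ≤ A₀)
    (hγ₀ : γ ≤ γ₀) (hb : 0 < b) (htail : ∀ k, k₀ ≤ k → ∀ v ∈ Box γ₀ k, b ≤ β k v)
    (hlo : ∀ k, ∀ v ∈ Box γ₀ k, -β' ≤ β k v) (hup : BetaUpperH β' γ₀ β)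
    (hBγ : (b + β') * k₀ * γ ^ 2 ≤ β₀ * (2 + β₀)) (hBγ' : (b + β') * k₀ * γ ^ 2 ≤ 1 / 2) {κ₀ : ℕ} (hκ : 6 ≤ κ₀)
    (hsmall : Real.sqrt 2 ^ (κ₀ - 6) * (2 * γ ^ 4 / b + γ ^ 6) < 1)
    (P : B12.RunParams) (hI : (C P).flow.InInterval γ P.K) :
    ∃ R : ℕ → ℕ, (∀ j, B14.IsRj L p ((C P).flow.g j) (R j)) ∧
      (B14.FlowIneq26 (C P).flow.g β' β₀ P.K ∧ B14.FlowIneq27 (C P).flow.g β' β₀ p P.K ∧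
        B14.FlowIneq28 (epsK A₀ p (C P).flow) (C P).flow.g β' β₀ P.K ∧
        B14FlowStep.FlowIneq29 R (C P).flow.g L β' β₀ P.K) ∧ B14FlowStep.SumIneq246 (C P).flow.g κ₀ P.K := by
  choose R hR using fun j => B14FlowStep.isRj_exists Sm.hL p ((C P).flow.g j)
  exact ⟨R, hR, flowControl_along_of_eventualLower hgen hhalt hcur Sm hA₀ hγ₀ hb htail hlo hup hBγ hBγ' hκ hsmall P hI
    R fun j _ => hR j⟩

end

end Literature.MathematicalPhysics.QuantumFieldTheory.Balaban1983to89.FlowStepRuns
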